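import Mathlib.Analysis.Normed.Module.Basic
import Literature.MathematicalPhysics.QuantumFieldTheory.Volkov2020.AppendixDiracNumerators
import Literature.MathematicalPhysics.QuantumFieldTheory.Volkov2020.ProjectorTreeExchange
import HarnessLib

/-!
# Volkov 2020 (NPB 961, 115232) **Lemma 3.8 — PROVED**: on the mass shell, every full contraction (each index name twice, contracted with g_{μν}) of γ_{ξ_l}(m+p̂₂)⋯γ_{ξ_1}(m+p̂₂)·γ_μ·(m+p̂₁)γ_{ν_1}⋯(m+p̂₁)γ_{ν_n} is ≈ c·γ_μ for a real number c — the operator form of the printed «𝒫[…] = 0» — from the Clifford relation γ_μγ_ν + γ_νγ_μ = 2g_{μν} and p₁² = p₂² = m² alone, by the printed induction on l + n; and, on top of it, the FIRST STEP of the proof of Lemma 3.9 («m + Q̂′_l = (m + q̂_l) + Q̂″_l … X can be expressed as the sum of analogous expressions 𝒫[…] with multipliers Q̂″_l or (m + q̂_l) … and with at least one multiplier Q̂″_l»): the exact 2^{2h}-term bracket expansion of the |P| = 0 numerator and X ≈ c·γ_μ + (the terms with at least one Q̂″)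

independent recomputation; certified where stated, statistical where stated; no new-physics claim.

CITATION HEADER (venture `QEDPrecision`, cell `pub-qed`, track TROPICAL seat V3b = `pub-qed-trop-v3-lit-2` gen 11; VALUE-FREE: identities in an abstract
Clifford algebra — nothing of X352, nothing per X352 word; the `word`s of this file are γ-matrix products). Continues `Volkov2020.AppendixDiracNumerators`
(B.37: `IsDirac`, p̂ = `sl`, p_μ = `lo`, (pq) = `dot`, the on-shell relation `OnShellEq`, `gamma_sl`, `sl_sl`, `sl_sq`), whose relation ≈ it equips with a
public calculus (§0). Serves `tropical/view/V3-VOLKOV-DEGREES.md` §B B.29.3 / B.33 («§3.3 Lemma 3.8, Lemma 3.9 (3.11): ✗ (analytic / γ-matrix identities)» —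
this file turns the Lemma 3.8 entry into ✓).

Source, VERBATIM. [Volkov2020] S. Volkov, Nucl. Phys. B 961 (2020) 115232 = arXiv:1912.04885v4 (cell e-print `iclos_arxiv.tex`, sha256 8613757ca2360833…,
held under `pub-qed-trop-v3-lit-2/sources/arxiv-1912.04885/`; journal p.15–16).
* **Lemma 3.8** (tex l.493–499): «The following equality is satisfied: 𝒫[∏_{j=l}^{1}(γ_{ξ_j}(m+p̂₂)) · γ_μ · ∏_{j=1}^{n}((m+p̂₁)γ_{ν_j})] = 0, where
  ξ₁,…,ξ_l,ν₁,…,ν_n are names of tensor indices; each name occurs twice in the selection; the convolution is performed over pairs of the same tensor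
  indices using g_{μν}.»
* **its proof** (tex l.500–523): «First, let us note that in the definition of 𝒫 we consider only expressions of the form ψ̄₂Γ(p₁,p₂)ψ₁, where
  (m−p̂₁)ψ₁ = 0, ψ̄₂(m−p̂₂) = 0, p₁² = p₂² = m². We will use the formula γ_{ξ_l}(m+p̂₂) = (m−p̂₂)γ_{ξ_l} + 2p_{2ξ_l}. The part of the expression corresponding
  to the first term of [its] right part is cancelled, as it was noted above. For considering the second term, we perform the convolution of p_{2ξ_l}
  with the corresponding multiplier γ_{…}. The convolution changes this γ_{…} to the corresponding p_{2…}. If this p_{2…} is to the left side of γ_μ, then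
  we use (p̂₂+m)p̂₂(p̂₂+m) = 2m²(p̂₂+m) and reduce the problem to the statement of the lemma with lesser l,n. If this p_{2…} occurred in the begin of the
  expression, we use that 𝒫[Γ] = (1/2m)𝒫[(p̂₂+m)Γ] in addition (this follows from the note in the beginning). The case when the p_{2…} occurs to the
  right side of γ_μ is considered analogously, using (p̂₁+m)p̂₂(p̂₁+m) = (2p₁p₂)(p̂₁+m), 𝒫[Γ] = (1/2m)𝒫[Γ(p̂₁+m)] and the fact that 2p₁p₂ = 2m² can be
  factorized out of 𝒫[…] (see Section 2.1). If l = 0, then we perform the analogous transformation from the right end of the product inside 𝒫[…].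
  If l = 0, n = 0, we use 𝒫γ_μ = 0. This completes the proof.»
* **Lemma 3.9, proof, first paragraph** (journal p.16; tex l.532–539): «Let us enumerate the lepton lines of G along the path: 1,2,…,2h. Then the sum
  in (3.11) can be expressed as X = 𝒫[γ_{…}(m+Q̂′_{2h})γ_{…} … (m+Q̂′_{h+1})γ_{…}γ_μγ_{…}(m+Q̂′_h)γ_{…} … (m+Q̂′_1)γ_{…}], where Q̂′_l = Q̂_l(z)/D(z) (see
  Section 2.2.1). Put Q″_l = Q′_l − q_l, where q_l = p₁ for 1 ≤ l ≤ h and q_l = p₂ for h+1 ≤ l ≤ 2h. Taking into account Lemma 3.8 and m+Q̂′_l =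
  (m+q̂_l)+Q̂″_l, we obtain that X can be expressed as the sum of analogous expressions 𝒫[…] with multipliers Q̂″_l or (m+q̂_l) instead of (m+Q̂′_l) and
  with at least one multiplier Q̂″_l.» (§2.2.1, tex l.222–231: with |P| = 0 every internal lepton line is unpaired and carries «m + Q̂_l(z)/D(z)», every
  vertex a γ_ν named by its photon — so X has exactly the shape of Lemma 3.8's product with (m+p̂₂), (m+p̂₁) replaced by line-dependent (m+Q̂′_l).)
* §2.1 (journal p.6–7; tex l.129–147), quoted in `AppendixDiracNumerators`: the metric, the Clifford relation, the form-factor decomposition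
  «ψ̄₂Γ_μψ₁ = ψ̄₂(f(q²)γ_μ − (1/2m)g(q²)σ_{μν}q^ν + h(q²)q_μ)ψ₁», 𝒫Γ = lim_{q²→0} g(q²).

READING (the modelling steps, flagged). «The Dirac gamma matrices» = any Clifford family γ in an ℝ-algebra A (`IsDirac`, B.37; the Dirac matrices and
Mathlib's `CliffordAlgebra` are instances). «In the definition of 𝒫 we consider only … (m−p̂₁)ψ₁ = 0, ψ̄₂(m−p̂₂) = 0» = the relation X ≈ Y :⟺ X − Y ∈
A(p̂₁−m) + (p̂₂−m)A (`OnShellEq`), with p₁² = p₂² = m² as hypotheses `dot p₁ p₁ = m^2`, `dot p₂ p₂ = m^2`, and m ≠ 0 (the printed 1/2m). The printed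
product with NAMED indices is a list of letters (`Letter`: `idx i` a γ carrying the name i, `gam α` a γ with a fixed Lorentz index, `P1` = (m+p̂₁), `P2` =
(m+p̂₂), `S1` = p̂₁, `S2` = p̂₂ — the factors the proof creates —, `G` = γ_μ); `word Ls Rs` is the printed product for the name lists Ls = [ξ_l,…,ξ₁] (in
the printed order j = l,…,1) and Rs = [ν₁,…,ν_n]. «Each name occurs twice in the selection» = every i ∈ Ls ++ Rs has `count i (Ls ++ Rs) = 2` (so ANY
pairing is covered: both occurrences left of γ_μ, both right, or one on each side; l, n ≥ 0 arbitrary). «The convolution is performed over pairs of the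
same tensor indices using g_{μν}» = `E C L w`: for a duplicate-free enumeration L of the names, Σ_{α} g^{αα}·(w with both γ's named L.head replaced by
γ_α), recursively (`E`; independent of the order of L — Fubini, `E_perm`, private). «𝒫[X] = 0» is rendered, exactly where the printed proof ends («we use
𝒫γ_μ = 0»), as: **X ≈ c·γ_μ for some real c**, i.e. X admits the on-shell decomposition f γ_μ − (1/2m) g σ_{μν}q^ν + h q_μ with g = h = 0. As in
B.37, 𝒫 as a FUNCTIONAL (uniqueness of (f,g,h), spinor algebra) is not defined in the tree, so this is the faithful kernel form of the lemma, not a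
statement about a functional 𝒫. The printed shortcut «2p₁p₂ = 2m²» (valid at q² = 0) is NOT used: the kernel statement keeps 2(p₁p₂) symbolic and holds
for all on-shell p₁, p₂; c is an explicit product of the step constants 4m², 4(p₁p₂) (not recorded in the statement). For Lemma 3.9's first
step the letters `aff v` = (m + v̂) and `vec v` = v̂ carry ARBITRARY vectors (the Q′_l, Q″_l, which in the paper are rational in z — here just
vectors, pointwise in z); `wordQ Ls Rs` is X's product with one vector per slot; a SELECTION marks, per slot, whether Q̂″_l = (Q′_l − q_l)^ or (m + q̂_l)
is taken (`wordSel`, q_l = p₂ left of γ_μ, p₁ right of it, as printed); `annots` lists all 2^n selections of a side, `annotsPos` those with at least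
one Q̂″; nothing about the SIZE of the coefficients (the analytic content of Lemma 3.9) is said.

WHAT THE KERNEL CERTIFIES (Mathlib + `AppendixDiracNumerators` only; every statement PROVED; no named fact, D-0026).
§0 (namespace `…AppendixNumerators`, the relation's public calculus) `OnShellEq.refl/symm/trans/plus/scale/cast`; `leftKill` (m−p̂₂)V ≈ 0 and `rightKill`
  U(m−p̂₁) ≈ 0 («is cancelled, as it was noted above»); `leftP2` (m+p̂₂)X ≈ 2mX and `rightP1` X(m+p̂₁) ≈ 2mX («𝒫[Γ] = (1/2m)𝒫[(p̂₂+m)Γ]», «… Γ(p̂₁+m)»).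
§1–§2 (namespace `…ProjectorVanishing`) the γ-product calculus: `Letter`, `Ctx`, `val`, `evalW`, `leftPart`, `rightPart`, `word`, `subst`, `substW`, `E`
  (private plumbing: name-free prefixes/suffixes factor out of E, a name-free segment may be replaced by a proportional one, E is linear in a γ-slot —
  Σ_α p^α·E(u γ_α v) = E(u p̂ v), «the convolution changes this γ_{…} to the corresponding p_{2…}» —, substitutions commute, Fubini).
§3 the printed identities, for every Clifford family: **`gam_P2`** γ_ξ(m+p̂₂) = (m−p̂₂)γ_ξ + 2p_{2ξ}; `P1_gam` (m+p̂₁)γ_ν = γ_ν(m−p̂₁) + 2p_{1ν} (the «l = 0»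
  mirror); **`P2_S2_P2`** (p̂₂+m)p̂₂(p̂₂+m) = 2m²(p̂₂+m); **`P1_S2_P1`** (p̂₁+m)p̂₂(p̂₁+m) = 2(p₁p₂)(p̂₁+m); `P1_S1_P1` (p̂₁+m)p̂₁(p̂₁+m) = 2m²(p̂₁+m) (mirror);
  `S2_P2_X` p̂₂(p̂₂+m)X ≈ 2m²X («occurred in the begin of the expression»), `X_P1_S2` X(p̂₁+m)p̂₂ ≈ 2(p₁p₂)X and `X_P1_S1` X(p̂₁+m)p̂₁ ≈ 2m²X (right end).
§4 the induction step in its three pairings: **`head_contract`** E(ξ∷L′)(γ_ξ(m+p̂₂)·u·γ_ξ·v) ≈ 2·E(L′)(u·p̂₂·v) (kill of the (m−p̂₂)γ_ξ part + contraction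
  of 2p_{2ξ} into the partner slot), `tail_contract` (mirror, p̂₁); **`stepLL`**, **`stepLR`**, **`stepRR`**: E(word) ≈ κ·E(word with the pair deleted),
  κ = 4m², 4(p₁p₂), 4m² — «reduce the problem to the statement of the lemma with lesser l, n».
§5 **`lemma38`**: for all name lists Ls, Rs in which every name occurs exactly twice and every duplicate-free enumeration L of the names,
  ∃ c : ℝ, E C L (word Ls Rs) ≈ c·γ_μ (by strong induction on l + n, `lemma38_main`; base «l = 0, n = 0»: the bare γ_μ, c = 1).
§6 (Lemma 3.9, first step) `E_slot_add` (E is additive in a slot, private); **`val_aff_split`** m + Q̂′ = (m + q̂) + (Q′ − q)^; **`expand_wordQ`**: E(wordQ) =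
  Σ over ALL selections (τ_L, τ_R) of E(wordSel τ_L τ_R) (exact, 2^{l}·2^{n} terms, as iterated list sums over `annots`); `wordSel_allFalse`: the unselected
  term is Lemma 3.8's `word`; `restSum` = the terms «with at least one multiplier Q̂″_l»; **`expand_wordQ_split`** E(wordQ) = E(word) + restSum (exact);
  **`lemma39_step1`**: under Lemma 3.8's hypotheses on the names, ∃ c : ℝ, E C L (wordQ Ls Rs) ≈ c·γ_μ + restSum.
NOT claimed: 𝒫 as a functional / form-factor uniqueness (B.37); Lemma 3.9 beyond its first step — «all other multipliers … are linear combinations of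
p̂₁, p̂₂ and 1 with coefficients that are less or equal 1», the cancellation of the T-terms with p[T] = q_l, the bound on Q″_l and the constant C of
(3.11) (its combinatorial 1-tree-exchange core is `Volkov2020.ProjectorTreeExchange`), (3.12); which Feynman-graph terms produce such products (§3.3's
use of the lemmas); anything numerical. TODO(general form): the word calculus of §1–§2 is generic finite-dimensional index gymnastics and could serve Lemma 3.9's
first half.

r2 (gen 12) — **LEMMA 3.9 MODULO THE PROJECTOR 𝒫** (§7–§9 appended; one more import, `Mathlib.Analysis.Normed.Module.Basic`; §0–§6 unchanged). Source,
VERBATIM, in addition: **Lemma 3.9** (journal p.16; tex l.525–531): «If |P|=0, then the following inequality is satisfied in terms of (3.10):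
|Σ_{j:P_j=P}[𝒫Π_j]Y_j(z)| ≤ C·max_{i∈Ph(E(G))} z′_i/max(z′_i, z_i), (3.11) where C is some constant that depends only on the structure of the graph
(and m), z′_i are defined in Lemma 3.4.»; its proof, second paragraph (journal p.16; tex l.543): «Let us fix the selection of the sum term and the line
l with the multiplier Q̂″_l. By X′ we denote the contribution of this term. All other multipliers (except γ_…) are linear combinations of p̂₁, p̂₂ and
1 with coefficients that are less or equal 1 (in absolute value); thus, it is sufficient to estimate the coefficients of Q″_l.»; §2.2.2 (journal p.9;
tex l.271–273): «these terms are eliminated by the magnetic moment projector, because 𝒫γ_μ = 0.» READING of r2 (flagged): from §7 on the algebra A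
is NORMED (`NormedRing`, `NormedAlgebra ℝ`, `NormOneClass` — any submultiplicative norm with ‖1‖ = 1 on the Dirac algebra qualifies); «X′» =
`E C L (wordSel C τL τR)`; the size of a coefficient vector v is `l1 v` = Σ_α|v^α| (so ‖v̂‖ ≤ l1(v)·Σ_α‖γ_α‖, `norm_sl_le`); the analytic input of
the third paragraph (the 1-tree exchange — `Volkov2020.ProjectorTreeExchange`, with `Volkov2020.MomentumRouting`'s |c(T)| ≤ 1 and q_l AS PRINTED)
enters as the HYPOTHESIS «l1(Q′_l − q_l) ≤ K·B, 0 ≤ B ≤ 1» on every slot (B standing for max_i z′_i/max(z′_i, z_i), K for the number of 1-tree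
terms times the size of p₁, p₂); 𝒫 is ANY ℝ-linear functional A → ℝ vanishing on U(p̂₁ − m), on (p̂₂ − m)V and on γ_μ with |𝒫x| ≤ N‖x‖ (the paper's
trace-formula 𝒫 is one such; its N is not computed here). WHAT r2 CERTIFIES (all PROVED; Mathlib + B.37 only; no named fact, D-0026 net debt 0):
§7 `l1`, `gammaSum`, `gammaBound`, `letterBound` (γ-letters ≤ max(1, Σ‖γ_α‖), (m + v̂) ≤ |m| + l1(v)Σ‖γ_α‖, v̂ ≤ l1(v)Σ‖γ_α‖), `norm_sl_le`,
  `norm_val_le`, `norm_evalW_le` (‖word‖ ≤ ∏ letter bounds), **`norm_E_le`**: ‖E C L w‖ ≤ 4^{|L|}·∏ letter bounds (a substitution γ_α for a name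
  keeps the bounds).
§8 `slotBound`, `slotConst`, **`prod_slotBound_le`** (a selection's slot product ≤ slotConst^{#slots}, times B as soon as one Q̂″ is taken),
  `any_of_mem_annotsPos`, `length_annots` (2^{#slots} selections), **`assemblyConst`** = 4^{|L|}·max(1, Σ‖γ_α‖)·slotConst^{nL+nR}·(2^{nL}2^{nR} + 2^{nR})
  — EXPLICIT, a function of the name and slot counts, m, Σ‖γ_α‖, p₁, p₂ and K only («depends only on the structure of the graph (and m)»),
  **`norm_E_wordSel_le`** (one term X′ ≤ 4^{|L|}·max(1, Σ‖γ_α‖)·slotConst^{nL+nR}·B), **`norm_restSum_le`**: ‖restSum‖ ≤ assemblyConst·B.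
§9 **`lemma39_modulo_projector`**: ∃ c R, E C L (wordQ Ls Rs) ≈ c·γ_μ + R ∧ ‖R‖ ≤ assemblyConst·B (Lemma 3.8's hypotheses on the names, m ≠ 0,
  p₁² = p₂² = m²); `functional_eq_of_onShellEq` (an admissible 𝒫 is constant on ≈-classes); **`abs_projector_le`**: |𝒫[E C L (wordQ Ls Rs)]| ≤
  N·assemblyConst·B for every admissible 𝒫 with 𝒫γ_μ = 0 and |𝒫x| ≤ N‖x‖ — the shape of (3.11).
This supersedes, in the operator sense just stated, the r1 NOT-claimed items «all other multipliers … less or equal 1», «the bound on Q″_l and the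
constant C of (3.11)»; STILL NOT claimed: (3.11) for the integrand itself (needs §2.2's Q_l(z)/D(z) as the slot vectors with B.38/B.40 threaded into
the hypothesis, and the paper's concrete 𝒫 with its N), (3.12)–(3.13) (their arithmetic is `Volkov2020.ProjectorFactorSectorExponent`), anything per
word of the cell; nothing of X352. Serves §B.47 of `tropical/view/V3-VOLKOV-DEGREES.md`.

r3 (gen 12) — **(3.11) FOR THE PARAMETRIC SLOT VECTORS** (§10 appended; one more import, `Volkov2020.ProjectorTreeExchange` = B.31/B.38; §0–§9
unchanged): the slot hypothesis «l1(Q′_l − q_l) ≤ K·B» of §8–§9 is DISCHARGED by B.38's coefficient bound. Source, VERBATIM, in addition: proof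
of Lemma 3.9, third paragraph (journal p.16–17; tex l.544–558): «Q″_l = (Q_l(z) − q_l D(z))/D(z). Both terms of the numerator can be expressed as
sums of the form Σ_T c(T)∏_{l∈E(G)∖T} z_l, where the summation goes over 1-trees T of G, the coefficients c(T) are linear combinations of p₁, p₂.
The terms corresponding to T are cancelled if l ∈ T and the momentum passing through l in T equals q_l … Suppose T is not cancelled. By
definition, put X′_T = ∏_{l∈E(G)∖T} z_l/D(z) … X′_T ≤ 1/(1 + z_i/z_j) … ≤ z′_i/max(z_i, z′_i). This completes the proof.» READING of r3 (flagged):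
a PARAMETRIC SLOT (`ParametricSlot C M z Lept q v`) is a slot vector v = Q′_l, l ∈ Lept(E(G)), with v − q_l = a·p₁ + b·p₂ where a, b are B.38's
`qCoeff M z l c c₀` for the two coordinates — c(T) the coordinate of p[T], c₀ that of q_l, |c(T)| ≤ 1, |c₀| ≤ 1, c(Lept) = c₀ («the momentum passing
through l in T equals q_l» for T = Lept(E(G)) — for vertex graphs these are `Volkov2020.MomentumRouting`'s `abs_momentumCoeffs_le_one` and
`momentumThrough_path`, not imported here); M is the cycle matroid with Lept(E(G)) a 1-tree and every photon i spanned by its lepton path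
`lpath i ⊆ Lept` (B.31's hypotheses, discharged for edge lists there); B(z) = `exchBound z Ph hPh lpath` = max_{i∈Ph} z′_i/max(z′_i, z_i) with
z′_i = `lineMax z (lpath i)` AS PRINTED. WHAT r3 CERTIFIES (all PROVED; no named fact): §10 `exchBound`, `exchBound_nonneg_le_one` (0 ≤ B(z) ≤ 1 for
z > 0), `ParametricSlot`, **`slotK`** = 2(#1-trees − 1)(l1 p₁ + l1 p₂), **`l1_sub_le_of_parametricSlot`**: l1(Q′_l − q_l) ≤ slotK·B(z) (B.38's
`abs_qCoeff_le` in both coordinates), **`lemma39_parametric`**: ∃ c R, E C L (wordQ Ls Rs) ≈ c·γ_μ + R ∧ ‖R‖ ≤ assemblyConst(slotK)·B(z), and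
**`abs_projector_le_parametric`: |𝒫[E C L (wordQ Ls Rs)]| ≤ N·assemblyConst(slotK)·max_{i∈Ph(E(G))} z′_i/max(z′_i, z_i)** for every admissible 𝒫 —
(3.11) with its printed right-hand side and C = N·assemblyConst(2(#1-trees − 1)(l1 p₁ + l1 p₂)) explicit. STILL NOT claimed: that the
magnetic-moment integrand's |P| = 0 numerator IS such an X (§2.2's derivation), the paper's concrete 𝒫 and its N, (3.12)–(3.13), anything per word;
nothing of X352. Serves §B.48 of `tropical/view/V3-VOLKOV-DEGREES.md`.

r4 (gen 14) — CORRIGENDUM TO THE r2 QUOTATION ONLY (no declaration, statement, proof or import changed): in the verbatim text of Lemma 3.9 above,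
the closing clause now reads «z′_i are defined in Lemma 3.4» as the source prints it (tex l.530 `$z'_i$ are defined in Lemma \ref{lemma_w}`, and
`\label{lemma_w}` is the fourth lemma of §3, tex l.362 = journal Lemma 3.4, p.12, «z′_i = max_{l∈LPath(i)} z_l»); r2/r3 had mis-copied the
cross-reference as «Lemma 3.7». Every Lean object was already stated with Lemma 3.4's z′ (`lineMax` of `Volkov2020.ProjectorTreeExchange`; cf. the
docstring of `lineMax_nonneg` in §10 below), so nothing else moves. [cite: Volkov2020, Lemma 3.9 (journal p.16) and Lemma 3.4 (journal p.12)]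
-/

namespace Literature.MathematicalPhysics.QuantumFieldTheory.Volkov2020

open Finset

/-! ## §0 The on-shell relation ≈ of `AppendixDiracNumerators`: public calculus -/

namespace AppendixNumerators

variable {A : Type*} [Ring A] [Algebra ℝ A] {γ : Fin 4 → A} (m : ℝ) (p₁ p₂ : Fin 4 → ℝ)

/-- X ≈ X. [cite: Volkov2020, §2.1 (journal p.6; tex l.133–140)] -/
theorem OnShellEq.refl (X : A) : OnShellEq γ m p₁ p₂ X X := ⟨0, 0, by simp⟩

/-- ≈ transported along equalities. [cite: Volkov2020, §2.1 (journal p.6; tex l.133–140)] -/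
theorem OnShellEq.cast {X Y X' Y' : A} (h : OnShellEq γ m p₁ p₂ X Y) (hX : X = X') (hY : Y = Y') :
    OnShellEq γ m p₁ p₂ X' Y' := by subst hX hY; exact h

/-- ≈ is additive: X ≈ Y, X′ ≈ Y′ ⟹ X + X′ ≈ Y + Y′. [cite: Volkov2020, §2.1 (journal p.6; tex l.133–140)] -/
theorem OnShellEq.plus {X Y X' Y' : A} (h : OnShellEq γ m p₁ p₂ X Y) (h' : OnShellEq γ m p₁ p₂ X' Y') :
    OnShellEq γ m p₁ p₂ (X + X') (Y + Y') := by
  obtain ⟨U, V, hUV⟩ := h; obtain ⟨U', V', hUV'⟩ := h'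
  refine ⟨U + U', V + V', ?_⟩
  rw [add_mul, mul_add, show X + X' - (Y + Y') = (X - Y) + (X' - Y') by abel, hUV, hUV']
  abel

/-- ≈ is homogeneous: X ≈ Y ⟹ cX ≈ cY («can be factorized out of 𝒫[…]»). [cite: Volkov2020, §2.1 (journal p.6–7); proof of Lemma 3.8 (p.16; tex l.519)] -/
theorem OnShellEq.scale {X Y : A} (c : ℝ) (h : OnShellEq γ m p₁ p₂ X Y) : OnShellEq γ m p₁ p₂ (c • X) (c • Y) := by
  obtain ⟨U, V, hUV⟩ := h
  refine ⟨c • U, c • V, ?_⟩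
  rw [← smul_sub, hUV, smul_add, smul_mul_assoc, mul_smul_comm]

/-- ≈ is symmetric. [cite: Volkov2020, §2.1 (journal p.6; tex l.133–140)] -/
theorem OnShellEq.symm {X Y : A} (h : OnShellEq γ m p₁ p₂ X Y) : OnShellEq γ m p₁ p₂ Y X := by
  obtain ⟨U, V, hUV⟩ := h
  refine ⟨-U, -V, ?_⟩
  rw [show Y - X = -(X - Y) by abel, hUV, neg_mul, mul_neg]; abel

/-- ≈ is transitive. [cite: Volkov2020, §2.1 (journal p.6; tex l.133–140)] -/
theorem OnShellEq.trans {X Y Z : A} (h : OnShellEq γ m p₁ p₂ X Y) (h' : OnShellEq γ m p₁ p₂ Y Z) :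
    OnShellEq γ m p₁ p₂ X Z := by
  obtain ⟨U, V, hUV⟩ := h; obtain ⟨U', V', hUV'⟩ := h'
  refine ⟨U + U', V + V', ?_⟩
  rw [show X - Z = (X - Y) + (Y - Z) by abel, hUV, hUV', add_mul, mul_add]; abel

/-- (m − p̂₂)·V ≈ 0: «ψ̄₂(m − p̂₂) = 0 … the part of the expression corresponding to the first term … is cancelled».
[cite: Volkov2020, proof of Lemma 3.8 (journal p.16; tex l.501–509)] -/
theorem OnShellEq.leftKill (V : A) : OnShellEq γ m p₁ p₂ ((m • (1 : A) - sl γ p₂) * V) 0 :=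
  ⟨0, -V, by rw [sub_zero, zero_mul, zero_add, mul_neg, ← neg_mul, neg_sub]⟩

/-- U·(m − p̂₁) ≈ 0: «(m − p̂₁)ψ₁ = 0» (the «l = 0» mirror of the cancellation). [cite: Volkov2020, proof of Lemma 3.8 (journal p.16; tex l.501–503, l.521)] -/
theorem OnShellEq.rightKill (U : A) : OnShellEq γ m p₁ p₂ (U * (m • (1 : A) - sl γ p₁)) 0 :=
  ⟨-U, 0, by rw [sub_zero, mul_zero, add_zero, neg_mul, ← mul_neg, neg_sub]⟩

/-- (m + p̂₂)X ≈ 2mX, i.e. «𝒫[Γ] = (1/2m)𝒫[(p̂₂+m)Γ]». [cite: Volkov2020, proof of Lemma 3.8 (journal p.16; tex l.513–516)] -/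
theorem OnShellEq.leftP2 (X : A) : OnShellEq γ m p₁ p₂ ((m • (1 : A) + sl γ p₂) * X) ((2 * m) • X) := by
  have h := (OnShellEq.left (γ := γ) m p₁ p₂ X).plus m p₁ p₂ (OnShellEq.refl (γ := γ) m p₁ p₂ (m • X))
  refine h.cast m p₁ p₂ ?_ ?_
  · rw [add_mul, smul_mul_assoc, one_mul, add_comm]
  · rw [two_mul, add_smul]

/-- X(m + p̂₁) ≈ 2mX, i.e. «𝒫[Γ] = (1/2m)𝒫[Γ(p̂₁+m)]». [cite: Volkov2020, proof of Lemma 3.8 (journal p.16; tex l.517–519)] -/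
theorem OnShellEq.rightP1 (X : A) : OnShellEq γ m p₁ p₂ (X * (m • (1 : A) + sl γ p₁)) ((2 * m) • X) := by
  have h := (OnShellEq.right (γ := γ) m p₁ p₂ X).plus m p₁ p₂ (OnShellEq.refl (γ := γ) m p₁ p₂ (m • X))
  refine h.cast m p₁ p₂ ?_ ?_
  · rw [mul_add, mul_smul_comm, mul_one, add_comm]
  · rw [two_mul, add_smul]

end AppendixNumerators

namespace ProjectorVanishing

open AppendixNumerators

variable {A : Type*} [Ring A] [Algebra ℝ A]

/-! ## §1 γ-products with named indices -/

/-- The factors of the printed product «γ_{ξ_j}(m+p̂₂) … γ_μ … (m+p̂₁)γ_{ν_j}» as letters: `idx i` = a γ carrying the index NAME i (to be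
contracted), `gam α` = γ_α with a fixed Lorentz index α, `P1` = (m+p̂₁), `P2` = (m+p̂₂), `S1` = p̂₁, `S2` = p̂₂ (created by the proof's
contractions), `G` = the free γ_μ; and, for Lemma 3.9's first step, `aff v` = (m + v̂) and `vec v` = v̂ for an arbitrary vector v (the
printed (m + Q̂′_l) and Q̂″_l). [cite: Volkov2020, Lemma 3.8 (journal p.15; tex l.493–499); proof of Lemma 3.9 (p.16; tex l.532–539)] -/
inductive Letter (ι : Type*)
  | idx (i : ι)
  | gam (α : Fin 4)
  | P1 | P2 | S1 | S2 | G
  | aff (v : Fin 4 → ℝ)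
  | vec (v : Fin 4 → ℝ)

open Letter

/-- The data of the lemma: the Clifford family γ, the mass m, the on-shell momenta p₁ (incoming, right) and p₂ (outgoing, left), the free index μ.
[cite: Volkov2020, Lemma 3.8 and its proof «ψ̄₂Γ(p₁,p₂)ψ₁ … p₁² = p₂² = m²» (journal p.15–16; tex l.493–504)] -/
structure Ctx (A : Type*) [Ring A] [Algebra ℝ A] where
  /-- the gamma matrices -/
  γ : Fin 4 → A
  /-- the lepton mass -/
  m : ℝ
  /-- incoming momentum (the (m+p̂₁) side) -/
  p₁ : Fin 4 → ℝ
  /-- outgoing momentum (the (m+p̂₂) side) -/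
  p₂ : Fin 4 → ℝ
  /-- the free Lorentz index of γ_μ -/
  μ : Fin 4

variable (C : Ctx A) {ι : Type*}

/-- The value of a name-free letter (a named γ gets the junk value 1: names are substituted by `gam α` before evaluation).
[cite: Volkov2020, Lemma 3.8 (journal p.15; tex l.493–499)] -/
def val : Letter ι → A
  | idx _ => 1
  | gam α => C.γ α
  | P1 => C.m • (1 : A) + sl C.γ C.p₁
  | P2 => C.m • (1 : A) + sl C.γ C.p₂
  | S1 => sl C.γ C.p₁
  | S2 => sl C.γ C.p₂
  | G => C.γ C.μ
  | aff v => C.m • (1 : A) + sl C.γ v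
  | vec v => sl C.γ v

/-- The product of the values of a list of letters. [cite: Volkov2020, Lemma 3.8 (journal p.15; tex l.493–499)] -/
def evalW (w : List (Letter ι)) : A := (w.map (val C)).prod

/-- evalW is multiplicative. [folklore] -/
private theorem evalW_append (u v : List (Letter ι)) : evalW C (u ++ v) = evalW C u * evalW C v := by
  unfold evalW; rw [List.map_append, List.prod_append]

/-- evalW of a cons. [folklore] -/
private theorem evalW_cons (c : Letter ι) (v : List (Letter ι)) : evalW C (c :: v) = val C c * evalW C v := by
  unfold evalW; rw [List.map_cons, List.prod_cons]

/-- evalW [] = 1. [folklore] -/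
private theorem evalW_nil : evalW C ([] : List (Letter ι)) = 1 := by unfold evalW; simp

/-- evalW of one letter. [folklore] -/
private theorem evalW_single (a : Letter ι) : evalW C [a] = val C a := by rw [evalW_cons, evalW_nil, mul_one]

/-- evalW of two letters. [folklore] -/
private theorem evalW_two (a b : Letter ι) : evalW C [a, b] = val C a * val C b := by
  rw [evalW_cons, evalW_cons, evalW_nil, mul_one]

/-- evalW of three letters. [folklore] -/
private theorem evalW_three (a b c : Letter ι) : evalW C [a, b, c] = val C a * val C b * val C c := by
  rw [evalW_cons, evalW_cons, evalW_cons, evalW_nil, mul_one, mul_assoc]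

/-- The left factor «∏_{j=l}^{1}(γ_{ξ_j}(m+p̂₂))» for Ls = [ξ_l,…,ξ₁]. [cite: Volkov2020, Lemma 3.8 (journal p.15; tex l.495–497)] -/
def leftPart (Ls : List ι) : List (Letter ι) := Ls.flatMap fun i => [idx i, P2]

/-- The right factor «∏_{j=1}^{n}((m+p̂₁)γ_{ν_j})» for Rs = [ν₁,…,ν_n]. [cite: Volkov2020, Lemma 3.8 (journal p.15; tex l.495–497)] -/
def rightPart (Rs : List ι) : List (Letter ι) := Rs.flatMap fun j => [P1, idx j]

/-- **The printed product** γ_{ξ_l}(m+p̂₂)⋯γ_{ξ₁}(m+p̂₂)·γ_μ·(m+p̂₁)γ_{ν₁}⋯(m+p̂₁)γ_{ν_n} with named indices.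
[cite: Volkov2020, Lemma 3.8 (journal p.15; tex l.495–497)] -/
def word (Ls Rs : List ι) : List (Letter ι) := leftPart Ls ++ [G] ++ rightPart Rs

/-- leftPart [] = []. [folklore] -/
private theorem leftPart_nil : leftPart ([] : List ι) = [] := rfl
/-- leftPart of a cons. [folklore] -/
private theorem leftPart_cons (i : ι) (Ls : List ι) : leftPart (i :: Ls) = [idx i, P2] ++ leftPart Ls := rfl
/-- leftPart is a monoid map. [folklore] -/
private theorem leftPart_append (L₁ L₂ : List ι) : leftPart (L₁ ++ L₂) = leftPart L₁ ++ leftPart L₂ := by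
  unfold leftPart; rw [List.flatMap_append]
/-- rightPart [] = []. [folklore] -/
private theorem rightPart_nil : rightPart ([] : List ι) = [] := rfl
/-- rightPart of a cons. [folklore] -/
private theorem rightPart_cons (j : ι) (Rs : List ι) : rightPart (j :: Rs) = [P1, idx j] ++ rightPart Rs := rfl
/-- rightPart is a monoid map. [folklore] -/
private theorem rightPart_append (R₁ R₂ : List ι) : rightPart (R₁ ++ R₂) = rightPart R₁ ++ rightPart R₂ := by
  unfold rightPart; rw [List.flatMap_append]

/-! ## §2 Contraction over names -/

variable [DecidableEq ι]

/-- Substitute γ_α for the γ's named i. [cite: Volkov2020, Lemma 3.8 «the convolution is performed over pairs of the same tensor indices using g_{μν}» (journal p.15; tex l.498)] -/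
def subst (i : ι) (α : Fin 4) : Letter ι → Letter ι
  | idx j => if j = i then gam α else idx j
  | x => x

/-- `subst` letterwise. [cite: Volkov2020, Lemma 3.8 (journal p.15; tex l.498)] -/
def substW (i : ι) (α : Fin 4) (w : List (Letter ι)) : List (Letter ι) := w.map (subst i α)

/-- **The contraction over a list of names** with the metric g = diag(1,−1,−1,−1): E [] w = value of w, E (i :: L) w = Σ_α g^{αα}·E L (w[i ↦ γ_α]).
[cite: Volkov2020, Lemma 3.8 «the convolution is performed over pairs of the same tensor indices using g_{μν}» (journal p.15; tex l.498)] -/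
def E : List ι → List (Letter ι) → A
  | [], w => evalW C w
  | i :: L, w => ∑ α, η α • E L (substW i α w)

/-- a letter mentions no name. [folklore] -/
private def concrete : Letter ι → Prop
  | idx _ => False
  | _ => True

/-- substW is a monoid map. [folklore] -/
private theorem substW_append (i : ι) (α : Fin 4) (u v : List (Letter ι)) :
    substW i α (u ++ v) = substW i α u ++ substW i α v := by
  unfold substW; rw [List.map_append]

/-- substW of a cons. [folklore] -/
private theorem substW_cons (i : ι) (α : Fin 4) (c : Letter ι) (v : List (Letter ι)) :
    substW i α (c :: v) = subst i α c :: substW i α v := rfl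

/-- substW [] = []. [folklore] -/
private theorem substW_nil (i : ι) (α : Fin 4) : substW i α ([] : List (Letter ι)) = [] := rfl

/-- name-free letters are fixed by subst. [folklore] -/
private theorem subst_of_concrete (i : ι) (α : Fin 4) {c : Letter ι} (hc : concrete c) : subst i α c = c := by
  cases c <;> simp [concrete] at hc ⊢ <;> rfl

/-- name-free lists are fixed by substW. [folklore] -/
private theorem substW_of_concrete (i : ι) (α : Fin 4) {u : List (Letter ι)} (hu : ∀ c ∈ u, concrete c) :
    substW i α u = u := by
  induction u with
  | nil => rfl
  | cons c u ih =>
    rw [substW_cons, subst_of_concrete i α (hu c (by simp)), ih (fun c' hc' => hu c' (by simp [hc']))]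

/-- a name-free prefix factors out of E. [folklore] -/
private theorem E_prefix (L : List ι) {u : List (Letter ι)} (hu : ∀ c ∈ u, concrete c) (w : List (Letter ι)) :
    E C L (u ++ w) = evalW C u * E C L w := by
  induction L generalizing w with
  | nil => simp only [E]; rw [evalW_append]
  | cons i L ih =>
    simp only [E]
    rw [Finset.mul_sum]
    refine Finset.sum_congr rfl fun α _ => ?_
    rw [substW_append, substW_of_concrete i α hu, ih, mul_smul_comm]

/-- a name-free suffix factors out of E. [folklore] -/
private theorem E_suffix (L : List ι) {u : List (Letter ι)} (hu : ∀ c ∈ u, concrete c) (w : List (Letter ι)) :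
    E C L (w ++ u) = E C L w * evalW C u := by
  induction L generalizing w with
  | nil => simp only [E]; rw [evalW_append]
  | cons i L ih =>
    simp only [E]
    rw [Finset.sum_mul]
    refine Finset.sum_congr rfl fun α _ => ?_
    rw [substW_append, substW_of_concrete i α hu, ih, smul_mul_assoc]

/-- replacing a name-free segment by another one with proportional value scales E. [folklore] -/
private theorem E_segment (L : List ι) {s s' : List (Letter ι)} (hs : ∀ c ∈ s, concrete c) (hs' : ∀ c ∈ s', concrete c)
    {r : ℝ} (hval : evalW C s = r • evalW C s') (u v : List (Letter ι)) :
    E C L (u ++ s ++ v) = r • E C L (u ++ s' ++ v) := by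
  induction L generalizing u v with
  | nil =>
    simp only [E]
    rw [evalW_append, evalW_append, evalW_append, evalW_append, hval, mul_smul_comm, smul_mul_assoc]
  | cons i L ih =>
    simp only [E]
    rw [Finset.smul_sum]
    refine Finset.sum_congr rfl fun α _ => ?_
    rw [substW_append, substW_append, substW_append, substW_append, substW_of_concrete i α hs,
      substW_of_concrete i α hs', ih, smul_smul, smul_smul, mul_comm]

/-- E is linear in one name-free γ-slot: Σ_α p^α·E(u γ_α v) = E(u X v) whenever X evaluates to p̂ («the convolution changes this γ_{…} to
the corresponding p_{2…}»). [folklore] -/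
private theorem E_slot_sl (L : List ι) (p : Fin 4 → ℝ) (X : Letter ι) (hX : concrete X) (hXval : val C X = sl C.γ p)
    (u v : List (Letter ι)) :
    ∑ α, p α • E C L (u ++ [gam α] ++ v) = E C L (u ++ [X] ++ v) := by
  induction L generalizing u v with
  | nil =>
    simp only [E]
    simp only [evalW_append, evalW_cons, evalW_nil, mul_one, hXval]
    unfold sl
    rw [Finset.mul_sum, Finset.sum_mul]
    refine Finset.sum_congr rfl fun α _ => ?_
    rw [mul_smul_comm, smul_mul_assoc]; rfl
  | cons i L ih =>
    simp only [E]
    have hg : ∀ α : Fin 4, concrete (gam α : Letter ι) := fun _ => trivial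
    have e1 : ∀ (α β : Fin 4), substW i β (u ++ [gam α] ++ v) = substW i β u ++ [gam α] ++ substW i β v := by
      intro α β; rw [substW_append, substW_append, substW_cons, subst_of_concrete _ _ (hg α)]; rfl
    have e2 : ∀ β : Fin 4, substW i β (u ++ [X] ++ v) = substW i β u ++ [X] ++ substW i β v := by
      intro β; rw [substW_append, substW_append, substW_cons, subst_of_concrete _ _ hX]; rfl
    simp_rw [e1, e2, ← ih, Finset.smul_sum]
    rw [Finset.sum_comm]
    refine Finset.sum_congr rfl fun β _ => Finset.sum_congr rfl fun α _ => ?_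
    rw [smul_comm]

/-- substitutions for different names commute. [folklore] -/
private theorem substW_comm {i j : ι} (hij : i ≠ j) (α β : Fin 4) (w : List (Letter ι)) :
    substW i α (substW j β w) = substW j β (substW i α w) := by
  unfold substW
  rw [List.map_map, List.map_map]
  congr 1
  funext c
  cases c with
  | idx k =>
    simp only [Function.comp, subst]
    by_cases hk : k = j
    · subst hk
      simp [hij.symm]
    · by_cases hk' : k = i
      · subst hk'; simp [hk]
      · simp [hk, hk']
  | _ => rfl

/-- E does not depend on the order of contraction (Fubini for the finite sums). [folklore] -/
private theorem E_perm {L L' : List ι} (h : L.Perm L') (hL : L.Nodup) (w : List (Letter ι)) : E C L w = E C L' w := by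
  induction h generalizing w with
  | nil => rfl
  | cons i _ ih =>
    simp only [E]
    exact Finset.sum_congr rfl fun α _ => by rw [ih (List.Nodup.of_cons hL)]
  | swap i j L =>
    have hij : i ≠ j := by
      intro h; subst h; simp at hL
    simp only [E, Finset.smul_sum]
    rw [Finset.sum_comm]
    refine Finset.sum_congr rfl fun α _ => Finset.sum_congr rfl fun β _ => ?_
    rw [smul_comm, substW_comm hij]
  | trans h₁ _ ih₁ ih₂ => rw [ih₁ hL, ih₂ (h₁.nodup_iff.1 hL)]

/-- a name absent from Ls is not substituted in leftPart Ls. [folklore] -/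
private theorem substW_leftPart_of_not_mem {ξ : ι} (α : Fin 4) {Ls : List ι} (h : ξ ∉ Ls) :
    substW ξ α (leftPart Ls) = leftPart Ls := by
  induction Ls with
  | nil => rfl
  | cons i Ls ih =>
    have hi : i ≠ ξ := fun e => h (by simp [e])
    rw [leftPart_cons, substW_append, ih (fun h' => h (List.mem_cons_of_mem _ h'))]
    simp [substW, subst, hi]

/-- a name absent from Rs is not substituted in rightPart Rs. [folklore] -/
private theorem substW_rightPart_of_not_mem {ξ : ι} (α : Fin 4) {Rs : List ι} (h : ξ ∉ Rs) :
    substW ξ α (rightPart Rs) = rightPart Rs := by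
  induction Rs with
  | nil => rfl
  | cons j Rs ih =>
    have hj : j ≠ ξ := fun e => h (by simp [e])
    rw [rightPart_cons, substW_append, ih (fun h' => h (List.mem_cons_of_mem _ h'))]
    simp [substW, subst, hj]

/-! ## §3 The printed one-step identities (every Clifford family) -/

section Alg
variable (hγ : IsDirac C.γ)
include hγ

/-- «γ_{ξ_l}(m+p̂₂) = (m−p̂₂)γ_{ξ_l} + 2p_{2ξ_l}». [cite: Volkov2020, proof of Lemma 3.8, displayed formula (journal p.16; tex l.505–508)] -/
theorem gam_P2 (α : Fin 4) : C.γ α * (C.m • (1 : A) + sl C.γ C.p₂) =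
    (C.m • (1 : A) - sl C.γ C.p₂) * C.γ α + (2 * lo C.p₂ α) • (1 : A) := by
  have e := gamma_sl hγ C.p₂ α
  rw [mul_add, mul_smul_comm, mul_one, sub_mul, smul_mul_assoc, one_mul, ← e]; abel

/-- The «l = 0» mirror: (m+p̂₁)γ_ν = γ_ν(m−p̂₁) + 2p_{1ν} («we perform the analogous transformation from the right end»).
[cite: Volkov2020, proof of Lemma 3.8 (journal p.16; tex l.505–508, l.521)] -/
theorem P1_gam (α : Fin 4) : (C.m • (1 : A) + sl C.γ C.p₁) * C.γ α =
    C.γ α * (C.m • (1 : A) - sl C.γ C.p₁) + (2 * lo C.p₁ α) • (1 : A) := by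
  have e := gamma_sl hγ C.p₁ α
  rw [add_mul, smul_mul_assoc, one_mul, mul_sub, mul_smul_comm, mul_one, ← e]; abel

/-- «(p̂₂+m)p̂₂(p̂₂+m) = 2m²(p̂₂+m)» (p₂² = m²). [cite: Volkov2020, proof of Lemma 3.8 (journal p.16; tex l.510–512)] -/
theorem P2_S2_P2 (h2 : dot C.p₂ C.p₂ = C.m ^ 2) :
    (C.m • (1 : A) + sl C.γ C.p₂) * sl C.γ C.p₂ * (C.m • (1 : A) + sl C.γ C.p₂) =
      (2 * C.m ^ 2) • (C.m • (1 : A) + sl C.γ C.p₂) := by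
  have hsq := sl_sq hγ C.p₂
  rw [h2] at hsq
  simp only [add_mul, mul_add, smul_mul_assoc, mul_smul_comm, one_mul, mul_one, hsq, smul_smul]
  module

/-- «(p̂₁+m)p̂₂(p̂₁+m) = (2p₁p₂)(p̂₁+m)» (p₁² = m²). [cite: Volkov2020, proof of Lemma 3.8 (journal p.16; tex l.517–519)] -/
theorem P1_S2_P1 (h1 : dot C.p₁ C.p₁ = C.m ^ 2) :
    (C.m • (1 : A) + sl C.γ C.p₁) * sl C.γ C.p₂ * (C.m • (1 : A) + sl C.γ C.p₁) =
      (2 * dot C.p₁ C.p₂) • (C.m • (1 : A) + sl C.γ C.p₁) := by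
  have hsq := sl_sq hγ C.p₁
  rw [h1] at hsq
  have e : sl C.γ C.p₂ * sl C.γ C.p₁ = (2 * dot C.p₁ C.p₂) • (1 : A) - sl C.γ C.p₁ * sl C.γ C.p₂ :=
    eq_sub_of_add_eq' (sl_sl hγ C.p₁ C.p₂)
  simp only [add_mul, mul_add, smul_mul_assoc, mul_smul_comm, one_mul, mul_one]
  rw [mul_assoc (sl C.γ C.p₁), e, mul_sub, ← mul_assoc, hsq, smul_mul_assoc, one_mul, mul_smul_comm, mul_one]
  module

/-- The «l = 0» mirror: (p̂₁+m)p̂₁(p̂₁+m) = 2m²(p̂₁+m) (p₁² = m²). [cite: Volkov2020, proof of Lemma 3.8 (journal p.16; tex l.510–512, l.521)] -/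
theorem P1_S1_P1 (h1 : dot C.p₁ C.p₁ = C.m ^ 2) :
    (C.m • (1 : A) + sl C.γ C.p₁) * sl C.γ C.p₁ * (C.m • (1 : A) + sl C.γ C.p₁) =
      (2 * C.m ^ 2) • (C.m • (1 : A) + sl C.γ C.p₁) := by
  have hsq := sl_sq hγ C.p₁
  rw [h1] at hsq
  simp only [add_mul, mul_add, smul_mul_assoc, mul_smul_comm, one_mul, mul_one, hsq, smul_smul]
  module

/-- Right end, «l = 0» case: X(m+p̂₁)p̂₁ ≈ 2m²X (since (m+p̂₁)p̂₁ = mp̂₁ + m² and Xp̂₁ ≈ mX).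
[cite: Volkov2020, proof of Lemma 3.8 (journal p.16; tex l.517–521)] -/
theorem X_P1_S1 (h1 : dot C.p₁ C.p₁ = C.m ^ 2) (X : A) :
    OnShellEq C.γ C.m C.p₁ C.p₂ (X * ((C.m • (1 : A) + sl C.γ C.p₁) * sl C.γ C.p₁)) ((2 * C.m ^ 2) • X) := by
  have hsq := sl_sq hγ C.p₁
  rw [h1] at hsq
  have e : X * ((C.m • (1 : A) + sl C.γ C.p₁) * sl C.γ C.p₁) = C.m • (X * sl C.γ C.p₁) + C.m ^ 2 • X := by
    rw [add_mul, smul_mul_assoc, one_mul, hsq, mul_add, mul_smul_comm, mul_smul_comm, mul_one]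
  have h := ((OnShellEq.right (γ := C.γ) C.m C.p₁ C.p₂ X).scale C.m C.p₁ C.p₂ C.m).plus C.m C.p₁ C.p₂
    (OnShellEq.refl (γ := C.γ) C.m C.p₁ C.p₂ (C.m ^ 2 • X))
  refine h.cast C.m C.p₁ C.p₂ e.symm ?_
  rw [smul_smul, ← add_smul]; congr 1; ring

/-- Right end with a trailing p̂₂: X(m+p̂₁)p̂₂ ≈ 2(p₁p₂)X, via «𝒫[Γ] = (1/2m)𝒫[Γ(p̂₁+m)]» and «(p̂₁+m)p̂₂(p̂₁+m) = (2p₁p₂)(p̂₁+m)» (m ≠ 0).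
[cite: Volkov2020, proof of Lemma 3.8 (journal p.16; tex l.517–519)] -/
theorem X_P1_S2 (hm : C.m ≠ 0) (h1 : dot C.p₁ C.p₁ = C.m ^ 2) (X : A) :
    OnShellEq C.γ C.m C.p₁ C.p₂ (X * ((C.m • (1 : A) + sl C.γ C.p₁) * sl C.γ C.p₂)) ((2 * dot C.p₁ C.p₂) • X) := by
  set P₁ : A := C.m • (1 : A) + sl C.γ C.p₁
  set Y : A := X * (P₁ * sl C.γ C.p₂)
  have hY : OnShellEq C.γ C.m C.p₁ C.p₂ Y ((1 / (2 * C.m)) • (Y * P₁)) := by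
    have h := ((OnShellEq.rightP1 (γ := C.γ) C.m C.p₁ C.p₂ Y).symm C.m C.p₁ C.p₂).scale C.m C.p₁ C.p₂ (1 / (2 * C.m))
    refine h.cast C.m C.p₁ C.p₂ ?_ rfl
    rw [smul_smul, div_mul_cancel₀ _ (mul_ne_zero two_ne_zero hm), one_smul]
  have e : Y * P₁ = (2 * dot C.p₁ C.p₂) • (X * P₁) := by
    simp only [Y, P₁]
    rw [mul_assoc, mul_assoc, ← mul_assoc (C.m • (1:A) + sl C.γ C.p₁), P1_S2_P1 C hγ h1, mul_smul_comm]
  have h2 := ((OnShellEq.rightP1 (γ := C.γ) C.m C.p₁ C.p₂ X).scale C.m C.p₁ C.p₂ (2 * dot C.p₁ C.p₂)).scale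
    C.m C.p₁ C.p₂ (1 / (2 * C.m))
  refine (hY.trans C.m C.p₁ C.p₂ (h2.cast C.m C.p₁ C.p₂ (by rw [e]) rfl)).cast C.m C.p₁ C.p₂ rfl ?_
  rw [smul_smul, smul_smul]; congr 1; field_simp

omit hγ in
/-- «If this p_{2…} occurred in the begin of the expression»: p̂₂(m+p̂₂)X ≈ 2m²X (via p̂₂Y ≈ mY and (m+p̂₂)X ≈ 2mX).
[cite: Volkov2020, proof of Lemma 3.8 (journal p.16; tex l.513–516)] -/
theorem S2_P2_X (X : A) :
    OnShellEq C.γ C.m C.p₁ C.p₂ (sl C.γ C.p₂ * (C.m • (1 : A) + sl C.γ C.p₂) * X) ((2 * C.m ^ 2) • X) := by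
  have h1 := OnShellEq.left (γ := C.γ) C.m C.p₁ C.p₂ ((C.m • (1 : A) + sl C.γ C.p₂) * X)
  have h2 := (OnShellEq.leftP2 (γ := C.γ) C.m C.p₁ C.p₂ X).scale C.m C.p₁ C.p₂ C.m
  refine (h1.cast C.m C.p₁ C.p₂ (by rw [mul_assoc]) rfl).trans C.m C.p₁ C.p₂ (h2.cast C.m C.p₁ C.p₂ rfl ?_)
  rw [smul_smul]; congr 1; ring

end Alg

/-! ## §4 The induction step: head/tail contraction and the three pairings -/

section Steps
variable (hγ : IsDirac C.γ)
include hγ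

/-- **Head contraction.** If the name ξ heads the product, «γ_ξ(m+p̂₂) …», and occurs once more in the slot between u and v, then
E (ξ :: L′) w ≈ 2·E L′ (u p̂₂ v): the (m−p̂₂)γ_ξ part «is cancelled» in the left ideal and «the convolution of p_{2ξ} with the corresponding
multiplier γ_{…} changes this γ_{…} to the corresponding p_{2…}». [cite: Volkov2020, proof of Lemma 3.8 (journal p.16; tex l.505–510)] -/
theorem head_contract (ξ : ι) (L' : List ι) (w u v : List (Letter ι))
    (hsub : ∀ α, substW ξ α w = [gam α, P2] ++ (u ++ [gam α] ++ v)) :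
    OnShellEq C.γ C.m C.p₁ C.p₂ (E C (ξ :: L') w) ((2 : ℝ) • E C L' (u ++ [S2] ++ v)) := by
  simp only [E]
  have key : ∀ α, η α • E C L' (substW ξ α w) =
      η α • ((C.m • (1 : A) - sl C.γ C.p₂) * (C.γ α * E C L' (u ++ [gam α] ++ v))) +
        (2 * C.p₂ α) • E C L' (u ++ [gam α] ++ v) := by
    intro α
    rw [hsub, E_prefix C L' (by simp [concrete]), evalW_two]
    simp only [val]
    rw [gam_P2 C hγ, add_mul, smul_add, mul_assoc, smul_mul_assoc, one_mul, smul_smul]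
    congr 2
    unfold lo
    rw [show η α * (2 * (η α * C.p₂ α)) = 2 * (η α * η α) * C.p₂ α by ring, η_mul_self, mul_one]
  rw [Finset.sum_congr rfl fun α _ => key α, Finset.sum_add_distrib]
  have hslot : ∑ α, (2 * C.p₂ α) • E C L' (u ++ [gam α] ++ v) = (2 : ℝ) • E C L' (u ++ [S2] ++ v) := by
    rw [← E_slot_sl C L' C.p₂ S2 (by simp [concrete]) rfl u v, Finset.smul_sum]
    refine Finset.sum_congr rfl fun α _ => ?_
    rw [smul_smul]
  rw [hslot]
  have hkill : OnShellEq C.γ C.m C.p₁ C.p₂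
      (∑ α, η α • ((C.m • (1 : A) - sl C.γ C.p₂) * (C.γ α * E C L' (u ++ [gam α] ++ v)))) 0 := by
    rw [show (∑ α, η α • ((C.m • (1 : A) - sl C.γ C.p₂) * (C.γ α * E C L' (u ++ [gam α] ++ v)))) =
        (C.m • (1 : A) - sl C.γ C.p₂) * ∑ α, η α • (C.γ α * E C L' (u ++ [gam α] ++ v)) by
      rw [Finset.mul_sum]; refine Finset.sum_congr rfl fun α _ => ?_; rw [mul_smul_comm]]
    exact OnShellEq.leftKill (γ := C.γ) C.m C.p₁ C.p₂ _
  exact (hkill.plus C.m C.p₁ C.p₂ (OnShellEq.refl (γ := C.γ) C.m C.p₁ C.p₂ _)).cast C.m C.p₁ C.p₂ rfl (zero_add _)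

/-- **Tail contraction** (the «l = 0» mirror): ν ends the product, «… (m+p̂₁)γ_ν», and occurs once more between u and v; then
E (ν :: L′) w ≈ 2·E L′ (u p̂₁ v). [cite: Volkov2020, proof of Lemma 3.8 (journal p.16; tex l.521)] -/
theorem tail_contract (ν : ι) (L' : List ι) (w u v : List (Letter ι))
    (hsub : ∀ α, substW ν α w = (u ++ [gam α] ++ v) ++ [P1, gam α]) :
    OnShellEq C.γ C.m C.p₁ C.p₂ (E C (ν :: L') w) ((2 : ℝ) • E C L' (u ++ [S1] ++ v)) := by
  simp only [E]
  have key : ∀ α, η α • E C L' (substW ν α w) =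
      η α • ((E C L' (u ++ [gam α] ++ v) * C.γ α) * (C.m • (1 : A) - sl C.γ C.p₁)) +
        (2 * C.p₁ α) • E C L' (u ++ [gam α] ++ v) := by
    intro α
    rw [hsub, E_suffix C L' (by simp [concrete]), evalW_two]
    simp only [val]
    rw [P1_gam C hγ, mul_add, smul_add, ← mul_assoc, mul_smul_comm, mul_one, smul_smul]
    congr 2
    unfold lo
    rw [show η α * (2 * (η α * C.p₁ α)) = 2 * (η α * η α) * C.p₁ α by ring, η_mul_self, mul_one]
  rw [Finset.sum_congr rfl fun α _ => key α, Finset.sum_add_distrib]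
  have hslot : ∑ α, (2 * C.p₁ α) • E C L' (u ++ [gam α] ++ v) = (2 : ℝ) • E C L' (u ++ [S1] ++ v) := by
    rw [← E_slot_sl C L' C.p₁ S1 (by simp [concrete]) rfl u v, Finset.smul_sum]
    refine Finset.sum_congr rfl fun α _ => ?_
    rw [smul_smul]
  rw [hslot]
  have hkill : OnShellEq C.γ C.m C.p₁ C.p₂
      (∑ α, η α • ((E C L' (u ++ [gam α] ++ v) * C.γ α) * (C.m • (1 : A) - sl C.γ C.p₁))) 0 := by
    rw [show (∑ α, η α • ((E C L' (u ++ [gam α] ++ v) * C.γ α) * (C.m • (1 : A) - sl C.γ C.p₁))) =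
        (∑ α, η α • (E C L' (u ++ [gam α] ++ v) * C.γ α)) * (C.m • (1 : A) - sl C.γ C.p₁) by
      rw [Finset.sum_mul]; refine Finset.sum_congr rfl fun α _ => ?_; rw [smul_mul_assoc]]
    exact OnShellEq.rightKill (γ := C.γ) C.m C.p₁ C.p₂ _
  exact (hkill.plus C.m C.p₁ C.p₂ (OnShellEq.refl (γ := C.γ) C.m C.p₁ C.p₂ _)).cast C.m C.p₁ C.p₂ rfl (zero_add _)

/-- **Step, both occurrences of ξ_l left of γ_μ** («this p_{2…} is to the left side of γ_μ», incl. «occurred in the begin of the expression»):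
E ≈ 4m²·E(the product with the pair deleted). [cite: Volkov2020, proof of Lemma 3.8 (journal p.16; tex l.509–516)] -/
theorem stepLL (h2 : dot C.p₂ C.p₂ = C.m ^ 2) (ξ : ι) (A B Rs L' : List ι)
    (hA : ξ ∉ A) (hB : ξ ∉ B) (hR : ξ ∉ Rs) :
    OnShellEq C.γ C.m C.p₁ C.p₂ (E C (ξ :: L') (word (ξ :: (A ++ ξ :: B)) Rs))
      ((2 * (2 * C.m ^ 2)) • E C L' (word (A ++ B) Rs)) := by
  have hsub : ∀ α, substW ξ α (word (ξ :: (A ++ ξ :: B)) Rs) =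
      [gam α, P2] ++ (leftPart A ++ [gam α] ++ (P2 :: (leftPart B ++ [G] ++ rightPart Rs))) := by
    intro α
    simp [word, leftPart_cons, leftPart_append, substW_append, substW_cons,
      substW_leftPart_of_not_mem α hA, substW_leftPart_of_not_mem α hB, substW_rightPart_of_not_mem α hR, subst]
  have h0 := head_contract C hγ ξ L' _ _ _ hsub
  rcases A.eq_nil_or_concat' with rfl | ⟨A', a, rfl⟩
  · have hw : leftPart ([] : List ι) ++ [S2] ++ (P2 :: (leftPart B ++ [G] ++ rightPart Rs)) =
        [S2, P2] ++ word B Rs := by simp [leftPart_nil, word]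
    rw [hw, E_prefix C L' (by simp [concrete]), evalW_two] at h0
    simp only [val] at h0
    have h1 := (S2_P2_X C (E C L' (word B Rs))).scale C.m C.p₁ C.p₂ (2 : ℝ)
    refine (h0.trans C.m C.p₁ C.p₂ (h1.cast C.m C.p₁ C.p₂ (by rw [mul_assoc]) rfl)).cast C.m C.p₁ C.p₂ rfl ?_
    rw [smul_smul, List.nil_append]
  · have hw : leftPart (A' ++ [a]) ++ [S2] ++ (P2 :: (leftPart B ++ [G] ++ rightPart Rs)) =
        (leftPart A' ++ [idx a]) ++ [P2, S2, P2] ++ word B Rs := by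
      simp [leftPart_append, leftPart_cons, leftPart_nil, word]
    have hw' : (leftPart A' ++ [idx a]) ++ [P2] ++ word B Rs = word (A' ++ [a] ++ B) Rs := by
      simp [leftPart_append, leftPart_cons, word]
    have hval : evalW C ([P2, S2, P2] : List (Letter ι)) = (2 * C.m ^ 2) • evalW C ([P2] : List (Letter ι)) := by
      rw [evalW_three, evalW_single]; simp only [val]; exact P2_S2_P2 C hγ h2
    rw [hw, E_segment C L' (by simp [concrete]) (by simp [concrete]) hval, hw'] at h0
    refine h0.cast C.m C.p₁ C.p₂ rfl ?_
    rw [smul_smul]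

/-- **Step, ξ_l paired with some ν_j right of γ_μ** («the p_{2…} occurs to the right side of γ_μ», incl. the right end):
E ≈ 4(p₁p₂)·E(the product with the pair deleted). [cite: Volkov2020, proof of Lemma 3.8 (journal p.16; tex l.516–519)] -/
theorem stepLR (hm : C.m ≠ 0) (h1 : dot C.p₁ C.p₁ = C.m ^ 2) (ξ : ι) (Ls' A B L' : List ι)
    (hL : ξ ∉ Ls') (hA : ξ ∉ A) (hB : ξ ∉ B) :
    OnShellEq C.γ C.m C.p₁ C.p₂ (E C (ξ :: L') (word (ξ :: Ls') (A ++ ξ :: B)))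
      ((2 * (2 * dot C.p₁ C.p₂)) • E C L' (word Ls' (A ++ B))) := by
  have hsub : ∀ α, substW ξ α (word (ξ :: Ls') (A ++ ξ :: B)) =
      [gam α, P2] ++ ((leftPart Ls' ++ [G] ++ rightPart A ++ [P1]) ++ [gam α] ++ rightPart B) := by
    intro α
    simp [word, leftPart_cons, rightPart_append, rightPart_cons, substW_append, substW_cons,
      substW_leftPart_of_not_mem α hL, substW_rightPart_of_not_mem α hA, substW_rightPart_of_not_mem α hB, subst]
  have h0 := head_contract C hγ ξ L' _ _ _ hsub
  rcases B with _ | ⟨b, B'⟩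
  · have hw : (leftPart Ls' ++ [G] ++ rightPart A ++ [P1]) ++ [S2] ++ rightPart ([] : List ι) =
        word Ls' A ++ [P1, S2] := by simp [word, rightPart_nil]
    rw [hw, E_suffix C L' (by simp [concrete]), evalW_two] at h0
    simp only [val] at h0
    have h1' := (X_P1_S2 C hγ hm h1 (E C L' (word Ls' A))).scale C.m C.p₁ C.p₂ (2 : ℝ)
    refine (h0.trans C.m C.p₁ C.p₂ h1').cast C.m C.p₁ C.p₂ rfl ?_
    rw [smul_smul, List.append_nil]
  · have hw : (leftPart Ls' ++ [G] ++ rightPart A ++ [P1]) ++ [S2] ++ rightPart (b :: B') =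
        (leftPart Ls' ++ [G] ++ rightPart A) ++ [P1, S2, P1] ++ ([idx b] ++ rightPart B') := by
      simp [rightPart_cons]
    have hw' : (leftPart Ls' ++ [G] ++ rightPart A) ++ [P1] ++ ([idx b] ++ rightPart B') =
        word Ls' (A ++ b :: B') := by
      simp [word, rightPart_append, rightPart_cons]
    have hval : evalW C ([P1, S2, P1] : List (Letter ι)) =
        (2 * dot C.p₁ C.p₂) • evalW C ([P1] : List (Letter ι)) := by
      rw [evalW_three, evalW_single]; simp only [val]; exact P1_S2_P1 C hγ h1
    rw [hw, E_segment C L' (by simp [concrete]) (by simp [concrete]) hval, hw'] at h0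
    refine h0.cast C.m C.p₁ C.p₂ rfl ?_
    rw [smul_smul]

/-- **Step, l = 0** («we perform the analogous transformation from the right end of the product»): the last name ν_n paired with an earlier ν_j:
E ≈ 4m²·E(the product with the pair deleted). [cite: Volkov2020, proof of Lemma 3.8 (journal p.16; tex l.521)] -/
theorem stepRR (h1 : dot C.p₁ C.p₁ = C.m ^ 2) (ν : ι) (A B L' : List ι) (hA : ν ∉ A) (hB : ν ∉ B) :
    OnShellEq C.γ C.m C.p₁ C.p₂ (E C (ν :: L') (word [] (A ++ ν :: (B ++ [ν]))))
      ((2 * (2 * C.m ^ 2)) • E C L' (word [] (A ++ B))) := by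
  have hsub : ∀ α, substW ν α (word [] (A ++ ν :: (B ++ [ν]))) =
      (([G] ++ rightPart A ++ [P1]) ++ [gam α] ++ rightPart B) ++ [P1, gam α] := by
    intro α
    simp [word, leftPart_nil, rightPart_append, rightPart_cons, rightPart_nil, substW_append, substW_cons,
      substW_nil, substW_rightPart_of_not_mem α hA, substW_rightPart_of_not_mem α hB, subst]
  have h0 := tail_contract C hγ ν L' _ _ _ hsub
  rcases B with _ | ⟨b, B'⟩
  · have hw : ([G] ++ rightPart A ++ [P1]) ++ [S1] ++ rightPart ([] : List ι) = word [] A ++ [P1, S1] := by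
      simp [word, rightPart_nil, leftPart_nil]
    rw [hw, E_suffix C L' (by simp [concrete]), evalW_two] at h0
    simp only [val] at h0
    have h1' := (X_P1_S1 C hγ h1 (E C L' (word [] A))).scale C.m C.p₁ C.p₂ (2 : ℝ)
    refine (h0.trans C.m C.p₁ C.p₂ h1').cast C.m C.p₁ C.p₂ rfl ?_
    rw [smul_smul, List.append_nil]
  · have hw : ([G] ++ rightPart A ++ [P1]) ++ [S1] ++ rightPart (b :: B') =
        ([G] ++ rightPart A) ++ [P1, S1, P1] ++ ([idx b] ++ rightPart B') := by simp [rightPart_cons]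
    have hw' : ([G] ++ rightPart A) ++ [P1] ++ ([idx b] ++ rightPart B') = word [] (A ++ b :: B') := by
      simp [word, leftPart_nil, rightPart_append, rightPart_cons]
    have hval : evalW C ([P1, S1, P1] : List (Letter ι)) = (2 * C.m ^ 2) • evalW C ([P1] : List (Letter ι)) := by
      rw [evalW_three, evalW_single]; simp only [val]; exact P1_S1_P1 C hγ h1
    rw [hw, E_segment C L' (by simp [concrete]) (by simp [concrete]) hval, hw'] at h0
    refine h0.cast C.m C.p₁ C.p₂ rfl ?_
    rw [smul_smul]

omit hγ in
/-- bookkeeping: the names after deleting a matched pair. [folklore] -/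
private theorem names_erase {L M M' : List ι} (hL : L.Nodup) (ξ : ι) (hnames : ∀ i, i ∈ L ↔ i ∈ M)
    (hc : ∀ i, i ≠ ξ → M.count i = M'.count i) (hξ : ξ ∉ M') : ∀ i, i ∈ L.erase ξ ↔ i ∈ M' := by
  intro i
  rw [List.Nodup.mem_erase_iff hL, hnames i]
  constructor
  · rintro ⟨hne, h⟩
    exact List.count_pos_iff.1 ((hc i hne) ▸ List.count_pos_iff.2 h)
  · intro h
    have hne : i ≠ ξ := fun e => hξ (e ▸ h)
    exact ⟨hne, List.count_pos_iff.1 ((hc i hne).symm ▸ List.count_pos_iff.2 h)⟩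

omit hγ in
/-- bookkeeping: «each name occurs twice» survives the deletion of a matched pair. [folklore] -/
private theorem count_erase2 {M M' : List ι} (ξ : ι) (hc : ∀ i, i ≠ ξ → M.count i = M'.count i) (hξ : ξ ∉ M')
    (hcount : ∀ i ∈ M, M.count i = 2) : ∀ i ∈ M', M'.count i = 2 := by
  intro i hi
  have hne : i ≠ ξ := fun e => hξ (e ▸ hi)
  rw [← hc i hne]
  exact hcount i (List.count_pos_iff.1 ((hc i hne).symm ▸ List.count_pos_iff.2 hi))

/-! ## §5 Lemma 3.8 -/

/-- **Lemma 3.8, the induction** («reduce the problem to the statement of the lemma with lesser l, n … If l = 0, n = 0, we use 𝒫γ_μ = 0»):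
strong induction on l + n over the three pairings `stepLL`, `stepLR`, `stepRR`. [cite: Volkov2020, Lemma 3.8 and its proof (journal p.15–16; tex l.493–523)] -/
theorem lemma38_main (hm : C.m ≠ 0) (h1 : dot C.p₁ C.p₁ = C.m ^ 2) (h2 : dot C.p₂ C.p₂ = C.m ^ 2) (n : ℕ) :
    ∀ (Ls Rs L : List ι), Ls.length + Rs.length ≤ n → L.Nodup →
      (∀ i, i ∈ L ↔ i ∈ Ls ++ Rs) → (∀ i ∈ Ls ++ Rs, (Ls ++ Rs).count i = 2) →
      ∃ c : ℝ, OnShellEq C.γ C.m C.p₁ C.p₂ (E C L (word Ls Rs)) (c • C.γ C.μ) := by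
  induction n using Nat.strong_induction_on with
  | _ n ih => ?_
  intro Ls Rs L hlen hL hnames hcount
  rcases Ls with _ | ⟨ξ, Ls'⟩
  · rcases Rs.eq_nil_or_concat' with hRs | ⟨Rs', ν, hRs⟩
    · subst hRs
      have hLnil : L = [] := List.eq_nil_iff_forall_not_mem.2 fun i hi => by simpa using (hnames i).1 hi
      subst hLnil
      refine ⟨1, ?_⟩
      simp only [E, word, leftPart_nil, rightPart_nil, List.nil_append, List.append_nil, evalW_single, val,
        one_smul]
      exact OnShellEq.refl (γ := C.γ) C.m C.p₁ C.p₂ _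
    · subst hRs
      have hc := hcount ν (by simp)
      have hν : ν ∈ Rs' := by
        have : 0 < Rs'.count ν := by simp [List.count_append] at hc; omega
        exact List.count_pos_iff.1 this
      obtain ⟨A, B, rfl⟩ := List.append_of_mem hν
      have hc' : A.count ν = 0 ∧ B.count ν = 0 := by simp [List.count_append] at hc; omega
      have hA : ν ∉ A := List.count_eq_zero.1 hc'.1
      have hB : ν ∉ B := List.count_eq_zero.1 hc'.2
      have hνL : ν ∈ L := (hnames ν).2 (by simp)
      rw [E_perm C (List.perm_cons_erase hνL) hL,
        show ((A ++ ν :: B) ++ [ν] : List ι) = A ++ ν :: (B ++ [ν]) by simp]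
      have hstep := stepRR C hγ h1 ν A B (L.erase ν) hA hB
      have hlt : ([] : List ι).length + (A ++ B).length < n := by simp at hlen ⊢; omega
      have hn' := names_erase (M' := ([] : List ι) ++ (A ++ B)) hL ν hnames
        (fun i hne => by simp [List.count_append, hne.symm]) (by simp [hA, hB])
      have hc2 := count_erase2 (M' := ([] : List ι) ++ (A ++ B)) ν
        (fun i hne => by simp [List.count_append, hne.symm]) (by simp [hA, hB]) hcount
      obtain ⟨c, hc⟩ := ih _ hlt [] (A ++ B) (L.erase ν) le_rfl (hL.erase ν) hn' hc2
      exact ⟨_, (hstep.trans C.m C.p₁ C.p₂ (hc.scale C.m C.p₁ C.p₂ _)).cast C.m C.p₁ C.p₂ rfl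
        (by rw [smul_smul])⟩
  · have hc := hcount ξ (by simp)
    have hc1 : Ls'.count ξ + Rs.count ξ = 1 := by simp [List.count_append] at hc; omega
    have hmem : ξ ∈ Ls' ++ Rs := by
      rw [← List.count_pos_iff, List.count_append]; omega
    have hξL : ξ ∈ L := (hnames ξ).2 (by simp)
    rw [E_perm C (List.perm_cons_erase hξL) hL]
    by_cases hξLs : ξ ∈ Ls'
    · obtain ⟨A, B, rfl⟩ := List.append_of_mem hξLs
      have hc' : A.count ξ = 0 ∧ B.count ξ = 0 ∧ Rs.count ξ = 0 := by
        simp [List.count_append] at hc; omega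
      have hA : ξ ∉ A := List.count_eq_zero.1 hc'.1
      have hB : ξ ∉ B := List.count_eq_zero.1 hc'.2.1
      have hR : ξ ∉ Rs := List.count_eq_zero.1 hc'.2.2
      have hstep := stepLL C hγ h2 ξ A B Rs (L.erase ξ) hA hB hR
      have hlt : (A ++ B).length + Rs.length < n := by simp at hlen ⊢; omega
      have hn' := names_erase (M' := (A ++ B) ++ Rs) hL ξ hnames
        (fun i hne => by simp [List.count_append, hne.symm]) (by simp [hA, hB, hR])
      have hc2 := count_erase2 (M' := (A ++ B) ++ Rs) ξ
        (fun i hne => by simp [List.count_append, hne.symm]) (by simp [hA, hB, hR]) hcount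
      obtain ⟨c, hc⟩ := ih _ hlt (A ++ B) Rs (L.erase ξ) le_rfl (hL.erase ξ) hn' hc2
      exact ⟨_, (hstep.trans C.m C.p₁ C.p₂ (hc.scale C.m C.p₁ C.p₂ _)).cast C.m C.p₁ C.p₂ rfl
        (by rw [smul_smul])⟩
    · have hξR : ξ ∈ Rs := (List.mem_append.1 hmem).resolve_left hξLs
      obtain ⟨A, B, rfl⟩ := List.append_of_mem hξR
      have hc' : A.count ξ = 0 ∧ B.count ξ = 0 := by
        have h0 : Ls'.count ξ = 0 := List.count_eq_zero.2 hξLs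
        simp [List.count_append] at hc; omega
      have hA : ξ ∉ A := List.count_eq_zero.1 hc'.1
      have hB : ξ ∉ B := List.count_eq_zero.1 hc'.2
      have hstep := stepLR C hγ hm h1 ξ Ls' A B (L.erase ξ) hξLs hA hB
      have hlt : Ls'.length + (A ++ B).length < n := by simp at hlen ⊢; omega
      have hn' := names_erase (M' := Ls' ++ (A ++ B)) hL ξ hnames
        (fun i hne => by simp [List.count_append, hne.symm]) (by simp [hA, hB, hξLs])
      have hc2 := count_erase2 (M' := Ls' ++ (A ++ B)) ξ
        (fun i hne => by simp [List.count_append, hne.symm]) (by simp [hA, hB, hξLs]) hcount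
      obtain ⟨c, hc⟩ := ih _ hlt Ls' (A ++ B) (L.erase ξ) le_rfl (hL.erase ξ) hn' hc2
      exact ⟨_, (hstep.trans C.m C.p₁ C.p₂ (hc.scale C.m C.p₁ C.p₂ _)).cast C.m C.p₁ C.p₂ rfl
        (by rw [smul_smul])⟩

/-- **Lemma 3.8 of [Volkov2020]** in the kernel: for every Clifford family γ, m ≠ 0, p₁² = p₂² = m², every product
γ_{ξ_l}(m+p̂₂)⋯γ_{ξ₁}(m+p̂₂)·γ_μ·(m+p̂₁)γ_{ν₁}⋯(m+p̂₁)γ_{ν_n} (`word Ls Rs`, Ls = [ξ_l,…,ξ₁], Rs = [ν₁,…,ν_n], l, n ≥ 0) in which «each name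
occurs twice», fully contracted with g_{μν} over the names (`E C L`, L any duplicate-free enumeration of the names), is ≈ c·γ_μ on shell for some
real c — so its σ_{μν}q^ν and q_μ form factors vanish: «𝒫[…] = 0». [cite: Volkov2020, Lemma 3.8 (journal p.15–16; tex l.493–523)] -/
theorem lemma38 (hm : C.m ≠ 0) (h1 : dot C.p₁ C.p₁ = C.m ^ 2) (h2 : dot C.p₂ C.p₂ = C.m ^ 2)
    (Ls Rs L : List ι) (hL : L.Nodup) (hnames : ∀ i, i ∈ L ↔ i ∈ Ls ++ Rs)
    (hcount : ∀ i ∈ Ls ++ Rs, (Ls ++ Rs).count i = 2) :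
    ∃ c : ℝ, OnShellEq C.γ C.m C.p₁ C.p₂ (E C L (word Ls Rs)) (c • C.γ C.μ) :=
  lemma38_main C hγ hm h1 h2 _ Ls Rs L le_rfl hL hnames hcount

end Steps

/-! ## §6 Lemma 3.9, first step: the bracket expansion m + Q̂′ = (m + q̂) + Q̂″ and Lemma 3.8 on the pure term -/

section Expansion

/-- All 2^n ways to mark the elements of a list (a mark = «take Q̂″_l instead of (m + q̂_l)» at that slot).
[cite: Volkov2020, proof of Lemma 3.9 «the sum of analogous expressions … with multipliers Q̂″_l or (m+q̂_l) instead of (m+Q̂′_l)» (journal p.16; tex l.538–539)] -/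
def annots {β : Type*} : List β → List (List (β × Bool))
  | [] => [[]]
  | b :: l => (annots l).map (List.cons (b, false)) ++ (annots l).map (List.cons (b, true))

/-- The markings «with at least one multiplier Q̂″_l». [cite: Volkov2020, proof of Lemma 3.9 (journal p.16; tex l.538–539)] -/
def annotsPos {β : Type*} : List β → List (List (β × Bool))
  | [] => []
  | b :: l => (annotsPos l).map (List.cons (b, false)) ++ (annots l).map (List.cons (b, true))

/-- a sum over the markings of b :: l splits by the mark of b. [folklore] -/
private theorem sum_annots_cons {β M : Type*} [AddCommMonoid M] (b : β) (l : List β) (f : List (β × Bool) → M) :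
    ((annots (b :: l)).map f).sum =
      ((annots l).map fun t => f ((b, false) :: t)).sum + ((annots l).map fun t => f ((b, true) :: t)).sum := by
  simp [annots, List.map_append, List.sum_append, List.map_map, Function.comp_def]

/-- a sum over all markings = the unmarked term + the sum over markings with at least one mark. [folklore] -/
private theorem sum_annots_eq {β M : Type*} [AddCommMonoid M] (l : List β) (f : List (β × Bool) → M) :
    ((annots l).map f).sum = f (l.map fun b => (b, false)) + ((annotsPos l).map f).sum := by
  induction l generalizing f with
  | nil => simp [annots, annotsPos]
  | cons b l ih =>
    rw [sum_annots_cons, ih]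
    simp [annotsPos, List.map_append, List.sum_append, List.map_map, Function.comp_def, add_assoc]

omit [DecidableEq ι] in
/-- Left slots with their own vectors: «γ_{…}(m + Q̂′_l)» for l = 2h,…,h+1. [cite: Volkov2020, proof of Lemma 3.9 (journal p.16; tex l.532–536)] -/
def leftPartQ (Ls : List (ι × (Fin 4 → ℝ))) : List (Letter ι) := Ls.flatMap fun iq => [idx iq.1, aff iq.2]

omit [DecidableEq ι] in
/-- Right slots with their own vectors: «(m + Q̂′_l)γ_{…}» for l = h,…,1. [cite: Volkov2020, proof of Lemma 3.9 (journal p.16; tex l.532–536)] -/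
def rightPartQ (Rs : List (ι × (Fin 4 → ℝ))) : List (Letter ι) := Rs.flatMap fun jq => [aff jq.2, idx jq.1]

omit [DecidableEq ι] in
/-- **X's product** «γ_{…}(m+Q̂′_{2h})γ_{…} … (m+Q̂′_{h+1})γ_{…}γ_μγ_{…}(m+Q̂′_h)γ_{…} … (m+Q̂′_1)γ_{…}» (the |P| = 0 numerator: one γ per vertex,
one (m + Q̂′_l) per line). [cite: Volkov2020, proof of Lemma 3.9 (journal p.16; tex l.532–536)] -/
def wordQ (Ls Rs : List (ι × (Fin 4 → ℝ))) : List (Letter ι) := leftPartQ Ls ++ [G] ++ rightPartQ Rs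

omit [DecidableEq ι] in
/-- A left slot after the choice: Q̂″_l = (Q′_l − p₂)^ if marked, (m + p̂₂) otherwise («q_l = p₂ for h+1 ≤ l ≤ 2h»).
[cite: Volkov2020, proof of Lemma 3.9 (journal p.16; tex l.537–539)] -/
def selL (t : (ι × (Fin 4 → ℝ)) × Bool) : List (Letter ι) :=
  [idx t.1.1, if t.2 then vec (t.1.2 - C.p₂) else P2]

omit [DecidableEq ι] in
/-- A right slot after the choice: Q̂″_l = (Q′_l − p₁)^ if marked, (m + p̂₁) otherwise («q_l = p₁ for 1 ≤ l ≤ h»).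
[cite: Volkov2020, proof of Lemma 3.9 (journal p.16; tex l.537–539)] -/
def selR (t : (ι × (Fin 4 → ℝ)) × Bool) : List (Letter ι) :=
  [if t.2 then vec (t.1.2 - C.p₁) else P1, idx t.1.1]

omit [DecidableEq ι] in
/-- the left factor after the choices. [cite: Volkov2020, proof of Lemma 3.9 (journal p.16; tex l.537–539)] -/
def leftSel (τ : List ((ι × (Fin 4 → ℝ)) × Bool)) : List (Letter ι) := τ.flatMap (selL C)

omit [DecidableEq ι] in
/-- the right factor after the choices. [cite: Volkov2020, proof of Lemma 3.9 (journal p.16; tex l.537–539)] -/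
def rightSel (τ : List ((ι × (Fin 4 → ℝ)) × Bool)) : List (Letter ι) := τ.flatMap (selR C)

omit [DecidableEq ι] in
/-- One of the «analogous expressions 𝒫[…] with multipliers Q̂″_l or (m+q̂_l) instead of (m+Q̂′_l)» (before 𝒫).
[cite: Volkov2020, proof of Lemma 3.9 (journal p.16; tex l.537–539)] -/
def wordSel (τL τR : List ((ι × (Fin 4 → ℝ)) × Bool)) : List (Letter ι) := leftSel C τL ++ [G] ++ rightSel C τR

/-- p̂ is additive. [folklore] -/
private theorem sl_add' (γ : Fin 4 → A) (p q : Fin 4 → ℝ) : sl γ (p + q) = sl γ p + sl γ q := by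
  unfold sl; rw [← Finset.sum_add_distrib]; exact Finset.sum_congr rfl fun μ _ => by rw [Pi.add_apply, add_smul]

/-- E is additive in one name-free slot. [folklore] -/
private theorem E_slot_add (L : List ι) (X Y Z : Letter ι) (hX : concrete X) (hY : concrete Y) (hZ : concrete Z)
    (hval : val C X = val C Y + val C Z) (u v : List (Letter ι)) :
    E C L (u ++ [X] ++ v) = E C L (u ++ [Y] ++ v) + E C L (u ++ [Z] ++ v) := by
  induction L generalizing u v with
  | nil =>
    simp only [E, evalW_append, evalW_single, hval, mul_add, add_mul]
  | cons i L ih =>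
    simp only [E]
    rw [← Finset.sum_add_distrib]
    refine Finset.sum_congr rfl fun α _ => ?_
    rw [substW_append, substW_append, substW_append, substW_append, substW_append, substW_append,
      substW_cons, substW_cons, substW_cons, subst_of_concrete _ _ hX, subst_of_concrete _ _ hY,
      subst_of_concrete _ _ hZ, substW_nil, ih, smul_add]

omit [DecidableEq ι] in
/-- «m + Q̂′_l = (m + q̂_l) + Q̂″_l», Q″_l = Q′_l − q_l. [cite: Volkov2020, proof of Lemma 3.9 (journal p.16; tex l.537–538)] -/
theorem val_aff_split (Q q : Fin 4 → ℝ) :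
    val C (aff Q : Letter ι) = val C (aff q : Letter ι) + val C (vec (Q - q) : Letter ι) := by
  simp only [val]
  rw [show Q = q + (Q - q) by abel, sl_add', add_assoc]
  congr 2; abel_nf

/-- expansion of the left slots (any prefix u, suffix v). [folklore] -/
private theorem expand_left (L : List ι) (Ls : List (ι × (Fin 4 → ℝ))) (u v : List (Letter ι)) :
    E C L (u ++ leftPartQ Ls ++ v) = ((annots Ls).map fun τ => E C L (u ++ leftSel C τ ++ v)).sum := by
  induction Ls generalizing u with
  | nil => simp [annots, leftPartQ, leftSel]
  | cons iq Ls ih =>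
    obtain ⟨i, Q⟩ := iq
    have hw : u ++ leftPartQ ((i, Q) :: Ls) ++ v = (u ++ [idx i]) ++ [aff Q] ++ (leftPartQ Ls ++ v) := by
      simp [leftPartQ]
    have hP2 : val C (aff Q : Letter ι) = val C (P2 : Letter ι) + val C (vec (Q - C.p₂) : Letter ι) := by
      rw [val_aff_split C Q C.p₂]; rfl
    rw [hw, E_slot_add C L (aff Q) P2 (vec (Q - C.p₂)) trivial trivial trivial hP2, sum_annots_cons]
    have e1 : (u ++ [idx i]) ++ [P2] ++ (leftPartQ Ls ++ v) = (u ++ [idx i, P2]) ++ leftPartQ Ls ++ v := by simp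
    have e2 : (u ++ [idx i]) ++ [vec (Q - C.p₂)] ++ (leftPartQ Ls ++ v) =
        (u ++ [idx i, vec (Q - C.p₂)]) ++ leftPartQ Ls ++ v := by simp
    rw [e1, e2, ih, ih]
    congr 1 <;> refine congrArg List.sum (List.map_congr_left fun τ _ => ?_) <;>
      simp [leftSel, selL]

/-- expansion of the right slots (any prefix u). [folklore] -/
private theorem expand_right (L : List ι) (Rs : List (ι × (Fin 4 → ℝ))) (u : List (Letter ι)) :
    E C L (u ++ rightPartQ Rs) = ((annots Rs).map fun τ => E C L (u ++ rightSel C τ)).sum := by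
  induction Rs generalizing u with
  | nil => simp [annots, rightPartQ, rightSel]
  | cons jq Rs ih =>
    obtain ⟨j, Q⟩ := jq
    have hw : u ++ rightPartQ ((j, Q) :: Rs) = u ++ [aff Q] ++ ([idx j] ++ rightPartQ Rs) := by
      simp [rightPartQ]
    have hP1 : val C (aff Q : Letter ι) = val C (P1 : Letter ι) + val C (vec (Q - C.p₁) : Letter ι) := by
      rw [val_aff_split C Q C.p₁]; rfl
    rw [hw, E_slot_add C L (aff Q) P1 (vec (Q - C.p₁)) trivial trivial trivial hP1, sum_annots_cons]
    have e1 : u ++ [P1] ++ ([idx j] ++ rightPartQ Rs) = (u ++ [P1, idx j]) ++ rightPartQ Rs := by simp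
    have e2 : u ++ [vec (Q - C.p₁)] ++ ([idx j] ++ rightPartQ Rs) =
        (u ++ [vec (Q - C.p₁), idx j]) ++ rightPartQ Rs := by simp
    rw [e1, e2, ih, ih]
    congr 1 <;> refine congrArg List.sum (List.map_congr_left fun τ _ => ?_) <;>
      simp [rightSel, selR]

/-- **The bracket expansion**: E(X's product) = Σ over all selections (τ_L, τ_R) of E(the selected product) — «X can be expressed as the sum
of analogous expressions …» (exact, before any use of Lemma 3.8). [cite: Volkov2020, proof of Lemma 3.9 (journal p.16; tex l.537–539)] -/
theorem expand_wordQ (L : List ι) (Ls Rs : List (ι × (Fin 4 → ℝ))) :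
    E C L (wordQ Ls Rs) =
      ((annots Ls).map fun τL => ((annots Rs).map fun τR => E C L (wordSel C τL τR)).sum).sum := by
  unfold wordQ
  rw [show leftPartQ Ls ++ [G] ++ rightPartQ Rs = [] ++ leftPartQ Ls ++ ([G] ++ rightPartQ Rs) by simp, expand_left]
  refine congrArg List.sum (List.map_congr_left fun τL _ => ?_)
  unfold wordSel
  rw [show [] ++ leftSel C τL ++ ([G] ++ rightPartQ Rs) = (leftSel C τL ++ [G]) ++ rightPartQ Rs by simp, expand_right]

omit [DecidableEq ι] in
/-- The selection with no Q̂″ at all is Lemma 3.8's product γ(m+p̂₂)…γ_μ…(m+p̂₁)γ. [cite: Volkov2020, proof of Lemma 3.9 «Taking into account Lemma 3.8» (journal p.16; tex l.538)] -/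
theorem wordSel_allFalse (Ls Rs : List (ι × (Fin 4 → ℝ))) :
    wordSel C (Ls.map fun b => (b, false)) (Rs.map fun b => (b, false)) =
      word (Ls.map Prod.fst) (Rs.map Prod.fst) := by
  unfold wordSel word
  congr 2
  · induction Ls with
    | nil => rfl
    | cons iq Ls ih => simp [leftSel, selL, leftPart_cons, List.flatMap_cons] at ih ⊢; exact ih
  · induction Rs with
    | nil => rfl
    | cons jq Rs ih => simp [rightSel, selR, rightPart_cons, List.flatMap_cons] at ih ⊢; exact ih

/-- **The terms «with at least one multiplier Q̂″_l»**: (≥ 1 mark on the left, any marks on the right) + (no mark on the left, ≥ 1 on the right).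
[cite: Volkov2020, proof of Lemma 3.9 (journal p.16; tex l.538–539)] -/
def restSum (L : List ι) (Ls Rs : List (ι × (Fin 4 → ℝ))) : A :=
  ((annotsPos Ls).map fun τL => ((annots Rs).map fun τR => E C L (wordSel C τL τR)).sum).sum +
    ((annotsPos Rs).map fun τR => E C L (wordSel C (Ls.map fun b => (b, false)) τR)).sum

/-- E(X's product) = E(Lemma 3.8's product) + (the terms with at least one Q̂″), exactly.
[cite: Volkov2020, proof of Lemma 3.9 (journal p.16; tex l.537–539)] -/
theorem expand_wordQ_split (L : List ι) (Ls Rs : List (ι × (Fin 4 → ℝ))) :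
    E C L (wordQ Ls Rs) = E C L (word (Ls.map Prod.fst) (Rs.map Prod.fst)) + restSum C L Ls Rs := by
  rw [expand_wordQ, sum_annots_eq, sum_annots_eq, wordSel_allFalse, restSum]
  abel

variable (hγ : IsDirac C.γ)
include hγ

/-- **Lemma 3.9, first step** («Taking into account Lemma 3.8 and m+Q̂′_l = (m+q̂_l)+Q̂″_l, we obtain that X can be expressed as the sum of
analogous expressions 𝒫[…] … with at least one multiplier Q̂″_l»): for every Clifford family, m ≠ 0, p₁² = p₂² = m², arbitrary slot vectors Q′_l
and every pairing of the vertex names, ∃ c : ℝ, E(X's product) ≈ c·γ_μ + restSum on shell.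
[cite: Volkov2020, proof of Lemma 3.9, first paragraph (journal p.16; tex l.532–539)] -/
theorem lemma39_step1 (hm : C.m ≠ 0) (h1 : dot C.p₁ C.p₁ = C.m ^ 2) (h2 : dot C.p₂ C.p₂ = C.m ^ 2)
    (Ls Rs : List (ι × (Fin 4 → ℝ))) (L : List ι) (hL : L.Nodup)
    (hnames : ∀ i, i ∈ L ↔ i ∈ Ls.map Prod.fst ++ Rs.map Prod.fst)
    (hcount : ∀ i ∈ Ls.map Prod.fst ++ Rs.map Prod.fst, (Ls.map Prod.fst ++ Rs.map Prod.fst).count i = 2) :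
    ∃ c : ℝ, OnShellEq C.γ C.m C.p₁ C.p₂ (E C L (wordQ Ls Rs)) (c • C.γ C.μ + restSum C L Ls Rs) := by
  obtain ⟨c, hc⟩ := lemma38 C hγ hm h1 h2 (Ls.map Prod.fst) (Rs.map Prod.fst) L hL hnames hcount
  refine ⟨c, ?_⟩
  rw [expand_wordQ_split]
  exact hc.plus C.m C.p₁ C.p₂ (OnShellEq.refl (γ := C.γ) C.m C.p₁ C.p₂ _)

end Expansion

end ProjectorVanishing

end Literature.MathematicalPhysics.QuantumFieldTheory.Volkov2020

namespace Literature.MathematicalPhysics.QuantumFieldTheory.Volkov2020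

namespace ProjectorVanishing

open AppendixNumerators Letter

/-! ## §7 (r2) Norm bounds for letters, words and contractions in a normed Clifford algebra -/

section Norms

variable {A : Type*} [NormedRing A] [NormedAlgebra ℝ A] [NormOneClass A]
variable (C : Ctx A) {ι : Type*}

/-- The ℓ¹ size of a 4-vector: Σ_α |v^α| (controls ‖v̂‖ ≤ Σ_α |v^α|·‖γ_α‖). [folklore] -/
def l1 (v : Fin 4 → ℝ) : ℝ := ∑ α, |v α|

/-- Σ_α ‖γ_α‖. [folklore] -/
def gammaSum : ℝ := ∑ α, ‖C.γ α‖

/-- A common bound for every γ-letter (≥ 1 so that un-substituted named γ's, evaluated as 1, are covered too). [folklore] -/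
def gammaBound : ℝ := max 1 (gammaSum C)

omit [NormOneClass A] in
/-- l1 ≥ 0. [folklore] -/
private theorem l1_nonneg (v : Fin 4 → ℝ) : 0 ≤ l1 v := Finset.sum_nonneg fun _ _ => abs_nonneg _

omit [NormOneClass A] in
/-- Σ‖γ‖ ≥ 0. [folklore] -/
private theorem gammaSum_nonneg : 0 ≤ gammaSum C := Finset.sum_nonneg fun _ _ => norm_nonneg _

omit [NormOneClass A] in
/-- the γ-bound is ≥ 1. [folklore] -/
private theorem one_le_gammaBound : 1 ≤ gammaBound C := le_max_left _ _

omit [NormOneClass A] in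
/-- ‖γ_α‖ ≤ bound. [folklore] -/
private theorem norm_gamma_le (α : Fin 4) : ‖C.γ α‖ ≤ gammaBound C :=
  (Finset.single_le_sum (f := fun β => ‖C.γ β‖) (fun _ _ => norm_nonneg _) (Finset.mem_univ α)).trans (le_max_right _ _)

omit [NormOneClass A] in
/-- **‖v̂‖ ≤ Σ_α|v^α| · Σ_α‖γ_α‖.** [cite: Volkov2020, §2.1 «p̂» (journal p.6; tex l.129)] -/
theorem norm_sl_le (v : Fin 4 → ℝ) : ‖sl C.γ v‖ ≤ l1 v * gammaSum C := by
  unfold sl l1 gammaSum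
  calc ‖∑ μ, v μ • C.γ μ‖ ≤ ∑ μ, ‖v μ • C.γ μ‖ := norm_sum_le _ _
    _ = ∑ μ, |v μ| * ‖C.γ μ‖ := Finset.sum_congr rfl fun μ _ => by rw [norm_smul, Real.norm_eq_abs]
    _ ≤ ∑ μ, |v μ| * ∑ α, ‖C.γ α‖ := Finset.sum_le_sum fun μ _ => mul_le_mul_of_nonneg_left
        (Finset.single_le_sum (f := fun α => ‖C.γ α‖) (fun _ _ => norm_nonneg _) (Finset.mem_univ μ)) (abs_nonneg _)
    _ = (∑ μ, |v μ|) * ∑ α, ‖C.γ α‖ := by rw [Finset.sum_mul]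

/-- **A bound for the value of each letter**: γ-letters (named, fixed, the free γ_μ) by the γ-bound, (m + v̂) by |m| + l1(v)·Σ‖γ‖, v̂ by
l1(v)·Σ‖γ‖. [cite: Volkov2020, proof of Lemma 3.9 «All other multipliers … are linear combinations of p̂₁, p̂₂ and 1» (journal p.16; tex l.541–543)] -/
def letterBound : Letter ι → ℝ
  | idx _ => gammaBound C
  | gam _ => gammaBound C
  | G => gammaBound C
  | P1 => |C.m| + l1 C.p₁ * gammaSum C
  | P2 => |C.m| + l1 C.p₂ * gammaSum C
  | S1 => l1 C.p₁ * gammaSum C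
  | S2 => l1 C.p₂ * gammaSum C
  | aff v => |C.m| + l1 v * gammaSum C
  | vec v => l1 v * gammaSum C

omit [NormOneClass A] in
/-- letter bounds are nonnegative. [folklore] -/
private theorem letterBound_nonneg (c : Letter ι) : 0 ≤ letterBound C c := by
  have h1 : 0 ≤ gammaBound C := zero_le_one.trans (one_le_gammaBound C)
  have h2 := gammaSum_nonneg C
  have h3 : ∀ v : Fin 4 → ℝ, 0 ≤ l1 v * gammaSum C := fun v => mul_nonneg (l1_nonneg v) h2
  have h4 : ∀ v : Fin 4 → ℝ, 0 ≤ |C.m| + l1 v * gammaSum C := fun v => add_nonneg (abs_nonneg _) (h3 v)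
  cases c <;> simp only [letterBound] <;> first | exact h1 | exact h3 _ | exact h4 _

/-- ‖m·1 + v̂‖ ≤ |m| + l1(v)Σ‖γ‖. [folklore] -/
private theorem norm_aff_le (v : Fin 4 → ℝ) : ‖C.m • (1 : A) + sl C.γ v‖ ≤ |C.m| + l1 v * gammaSum C := by
  calc ‖C.m • (1 : A) + sl C.γ v‖ ≤ ‖C.m • (1 : A)‖ + ‖sl C.γ v‖ := norm_add_le _ _
    _ ≤ |C.m| + l1 v * gammaSum C := by
        rw [norm_smul, norm_one, mul_one, Real.norm_eq_abs]
        exact add_le_add le_rfl (norm_sl_le C v)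

/-- **‖value of a letter‖ ≤ its bound.** [cite: Volkov2020, proof of Lemma 3.9 (journal p.16; tex l.541–543)] -/
theorem norm_val_le (c : Letter ι) : ‖val C c‖ ≤ letterBound C c := by
  cases c with
  | idx i => simp only [val, letterBound, norm_one]; exact one_le_gammaBound C
  | gam α => exact norm_gamma_le C α
  | P1 => exact norm_aff_le C C.p₁
  | P2 => exact norm_aff_le C C.p₂
  | S1 => exact norm_sl_le C C.p₁
  | S2 => exact norm_sl_le C C.p₂
  | G => exact norm_gamma_le C C.μ
  | aff v => exact norm_aff_le C v
  | vec v => exact norm_sl_le C v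

/-- **‖product of a word‖ ≤ ∏ letter bounds.** [cite: Volkov2020, proof of Lemma 3.9 «All other multipliers (except γ_…) are linear combinations
of p̂₁, p̂₂ and 1 with coefficients that are less or equal 1 (in absolute value)» (journal p.16; arXiv:1912.04885v4 tex l.543)] -/
theorem norm_evalW_le (w : List (Letter ι)) : ‖evalW C w‖ ≤ (w.map (letterBound C)).prod := by
  induction w with
  | nil => simp [evalW]
  | cons c w ih =>
    have hc := norm_val_le C c
    have h0 : 0 ≤ letterBound C c := letterBound_nonneg C c
    have h1 : 0 ≤ (w.map (letterBound C)).prod := List.prod_nonneg fun x hx => by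
      obtain ⟨c', _, rfl⟩ := List.mem_map.1 hx; exact letterBound_nonneg C c'
    show ‖((c :: w).map (val C)).prod‖ ≤ ((c :: w).map (letterBound C)).prod
    rw [List.map_cons, List.prod_cons, List.map_cons, List.prod_cons]
    calc ‖val C c * (w.map (val C)).prod‖ ≤ ‖val C c‖ * ‖(w.map (val C)).prod‖ := norm_mul_le _ _
      _ ≤ letterBound C c * (w.map (letterBound C)).prod := mul_le_mul hc ih (norm_nonneg _) h0

variable [DecidableEq ι]

omit [NormOneClass A] in
/-- Substituting γ_α for a name does not change the bound of a letter. [folklore] -/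
private theorem letterBound_subst (i : ι) (α : Fin 4) (c : Letter ι) : letterBound C (subst i α c) = letterBound C c := by
  cases c <;> simp only [subst, letterBound]
  split_ifs <;> rfl

omit [NormOneClass A] in
/-- … nor of a word. [folklore] -/
private theorem map_letterBound_substW (i : ι) (α : Fin 4) (w : List (Letter ι)) :
    (substW i α w).map (letterBound C) = w.map (letterBound C) := by
  unfold substW
  rw [List.map_map]
  exact List.map_congr_left fun c _ => letterBound_subst C i α c

/-- **‖contraction over |L| names‖ ≤ 4^{|L|} · ∏ letter bounds** (each name sums four terms with |g^{αα}| = 1).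
[cite: Volkov2020, Lemma 3.8 «the convolution is performed over pairs of the same tensor indices using g_{μν}» (journal p.15; tex l.498)] -/
theorem norm_E_le (L : List ι) (w : List (Letter ι)) : ‖E C L w‖ ≤ 4 ^ L.length * (w.map (letterBound C)).prod := by
  induction L generalizing w with
  | nil => simpa [E] using norm_evalW_le C w
  | cons i L ih =>
    simp only [E, List.length_cons, pow_succ]
    calc ‖∑ α, η α • E C L (substW i α w)‖ ≤ ∑ α, ‖η α • E C L (substW i α w)‖ := norm_sum_le _ _
      _ = ∑ α, ‖E C L (substW i α w)‖ := Finset.sum_congr rfl fun α _ => by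
          rw [norm_smul, Real.norm_eq_abs, show |η α| = 1 by fin_cases α <;> simp [η], one_mul]
      _ ≤ ∑ _α : Fin 4, 4 ^ L.length * (w.map (letterBound C)).prod := Finset.sum_le_sum fun α _ => by
          have h := ih (substW i α w); rwa [map_letterBound_substW] at h
      _ = 4 ^ L.length * 4 * (w.map (letterBound C)).prod := by
          rw [Finset.sum_const, Finset.card_univ, Fintype.card_fin, nsmul_eq_mul]; push_cast; ring

end Norms

/-! ## §8 (r2) The terms «with at least one multiplier Q̂″_l» are O(max_i z′_i/max(z′_i, z_i)) -/

/-- ‖Σ list‖ ≤ Σ ‖·‖. [folklore] -/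
private theorem norm_list_sum_le' {E : Type*} [SeminormedAddCommGroup E] (l : List E) :
    ‖l.sum‖ ≤ (l.map fun x => ‖x‖).sum :=
  List.le_sum_of_subadditive (fun x : E => ‖x‖) norm_zero.le norm_add_le l

section RestBound

variable {A : Type*} [NormedRing A] [NormedAlgebra ℝ A] [NormOneClass A]
variable (C : Ctx A) {ι : Type*} [DecidableEq ι]

/-- The bound of one selected slot: γ-bound × (Σ‖γ‖·l1(Q′−q) if the Q̂″ is taken, |m| + Σ‖γ‖·l1(q) otherwise). [cite: Volkov2020, proof of Lemma 3.9 (journal p.16; tex l.537–543)] -/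
def slotBound (q : Fin 4 → ℝ) (t : (ι × (Fin 4 → ℝ)) × Bool) : ℝ :=
  gammaBound C * (if t.2 then l1 (t.1.2 - q) * gammaSum C else |C.m| + l1 q * gammaSum C)

omit [NormOneClass A] [DecidableEq ι] in
/-- letter bounds of a selected left slot. [folklore] -/
private theorem prod_selL (t : (ι × (Fin 4 → ℝ)) × Bool) :
    ((selL C t).map (letterBound C)).prod = slotBound C C.p₂ t := by
  unfold selL slotBound
  by_cases h : t.2 <;> simp [h, letterBound]

omit [NormOneClass A] [DecidableEq ι] in
/-- letter bounds of a selected right slot. [folklore] -/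
private theorem prod_selR (t : (ι × (Fin 4 → ℝ)) × Bool) :
    ((selR C t).map (letterBound C)).prod = slotBound C C.p₁ t := by
  unfold selR slotBound
  by_cases h : t.2 <;> simp [h, letterBound, mul_comm]

omit [NormOneClass A] [DecidableEq ι] in
/-- letter bounds of the selected left factor. [folklore] -/
private theorem prod_leftSel (τ : List ((ι × (Fin 4 → ℝ)) × Bool)) :
    ((leftSel C τ).map (letterBound C)).prod = (τ.map (slotBound C C.p₂)).prod := by
  induction τ with
  | nil => simp [leftSel]
  | cons t τ ih =>
    simp only [leftSel, List.flatMap_cons, List.map_append, List.prod_append, List.map_cons, List.prod_cons] at ih ⊢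
    rw [ih, prod_selL]

omit [NormOneClass A] [DecidableEq ι] in
/-- letter bounds of the selected right factor. [folklore] -/
private theorem prod_rightSel (τ : List ((ι × (Fin 4 → ℝ)) × Bool)) :
    ((rightSel C τ).map (letterBound C)).prod = (τ.map (slotBound C C.p₁)).prod := by
  induction τ with
  | nil => simp [rightSel]
  | cons t τ ih =>
    simp only [rightSel, List.flatMap_cons, List.map_append, List.prod_append, List.map_cons, List.prod_cons] at ih ⊢
    rw [ih, prod_selR]

/-- The uniform slot constant: γ-bound × max(Σ‖γ‖·K, |m| + Σ‖γ‖·max(l1 p₁, l1 p₂)). [folklore] -/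
def slotConst (K : ℝ) : ℝ :=
  gammaBound C * max (K * gammaSum C) (|C.m| + max (l1 C.p₁) (l1 C.p₂) * gammaSum C)

omit [NormOneClass A] [DecidableEq ι] in
/-- **One selection's slot product**: if every taken Q̂″ has l1(Q′ − q) ≤ K·B with 0 ≤ B ≤ 1, the product of the slot bounds is at most
slotConst^{#slots}, times B as soon as at least one Q̂″ is taken. [cite: Volkov2020, proof of Lemma 3.9 «with at least one multiplier Q̂″_l … it is sufficient to estimate the coefficients of Q″_l» (journal p.16; tex l.538–543)] -/
theorem prod_slotBound_le {K B : ℝ} (hK : 0 ≤ K) (hB0 : 0 ≤ B) (hB1 : B ≤ 1) (q : Fin 4 → ℝ)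
    (hq : l1 q ≤ max (l1 C.p₁) (l1 C.p₂)) (τ : List ((ι × (Fin 4 → ℝ)) × Bool))
    (hτ : ∀ t ∈ τ, t.2 = true → l1 (t.1.2 - q) ≤ K * B) :
    (τ.map (slotBound C q)).prod ≤ slotConst C K ^ τ.length * (if τ.any (fun t => t.2) then B else 1) := by
  have hΓ1 := one_le_gammaBound C
  have hΓ0 : 0 ≤ gammaBound C := zero_le_one.trans hΓ1
  have hS := gammaSum_nonneg C
  have hM0 : 0 ≤ slotConst C K := mul_nonneg hΓ0 ((mul_nonneg hK hS).trans (le_max_left _ _))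
  -- each slot: ≤ slotConst, and ≤ slotConst · B if marked
  have hslot : ∀ t ∈ τ, slotBound C q t ≤ slotConst C K * (if t.2 then B else 1) := by
    intro t ht
    unfold slotBound slotConst
    by_cases h : t.2
    · rw [if_pos h, if_pos h]
      have h1 : l1 (t.1.2 - q) * gammaSum C ≤ K * B * gammaSum C := mul_le_mul_of_nonneg_right (hτ t ht h) hS
      calc gammaBound C * (l1 (t.1.2 - q) * gammaSum C) ≤ gammaBound C * (K * B * gammaSum C) :=
            mul_le_mul_of_nonneg_left h1 hΓ0
        _ = gammaBound C * (K * gammaSum C) * B := by ring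
        _ ≤ gammaBound C * max (K * gammaSum C) (|C.m| + max (l1 C.p₁) (l1 C.p₂) * gammaSum C) * B :=
            mul_le_mul_of_nonneg_right (mul_le_mul_of_nonneg_left (le_max_left _ _) hΓ0) hB0
    · rw [if_neg h, if_neg h, mul_one]
      refine mul_le_mul_of_nonneg_left ?_ hΓ0
      exact (add_le_add le_rfl (mul_le_mul_of_nonneg_right hq hS)).trans (le_max_right _ _)
  have hslot0 : ∀ t ∈ τ, 0 ≤ slotBound C q t := fun t _ => by
    unfold slotBound
    refine mul_nonneg hΓ0 ?_
    split_ifs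
    · exact mul_nonneg (l1_nonneg _) hS
    · exact add_nonneg (abs_nonneg _) (mul_nonneg (l1_nonneg _) hS)
  induction τ with
  | nil => simp
  | cons t τ ih =>
    have iht := ih (fun t' ht' => hτ t' (List.mem_cons_of_mem _ ht')) (fun t' ht' => hslot t' (List.mem_cons_of_mem _ ht'))
      (fun t' ht' => hslot0 t' (List.mem_cons_of_mem _ ht'))
    rw [List.map_cons, List.prod_cons, List.length_cons, pow_succ, List.any_cons]
    have ht := hslot t (List.mem_cons_self ..)
    have ht0 := hslot0 t (List.mem_cons_self ..)
    have hrest0 : 0 ≤ (τ.map (slotBound C q)).prod := List.prod_nonneg fun x hx => by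
      obtain ⟨t', ht', rfl⟩ := List.mem_map.1 hx; exact hslot0 t' (List.mem_cons_of_mem _ ht')
    have hany1 : (if τ.any (fun t => t.2) then B else 1) ≤ (1 : ℝ) := by split_ifs <;> linarith
    have hany0 : (0 : ℝ) ≤ (if τ.any (fun t => t.2) then B else 1) := by split_ifs <;> linarith
    by_cases h : t.2
    · rw [if_pos h] at ht
      simp only [h, Bool.true_or, if_true]
      calc slotBound C q t * (τ.map (slotBound C q)).prod
          ≤ (slotConst C K * B) * (slotConst C K ^ τ.length * (if τ.any (fun t => t.2) then B else 1)) :=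
            mul_le_mul ht iht hrest0 (mul_nonneg hM0 hB0)
        _ ≤ (slotConst C K * B) * (slotConst C K ^ τ.length * 1) :=
            mul_le_mul_of_nonneg_left (mul_le_mul_of_nonneg_left hany1 (pow_nonneg hM0 _)) (mul_nonneg hM0 hB0)
        _ = slotConst C K ^ τ.length * slotConst C K * B := by ring
    · rw [if_neg h] at ht
      simp only [h, Bool.false_or]
      calc slotBound C q t * (τ.map (slotBound C q)).prod
          ≤ (slotConst C K * 1) * (slotConst C K ^ τ.length * (if τ.any (fun t => t.2) then B else 1)) :=
            mul_le_mul ht iht hrest0 (mul_nonneg hM0 zero_le_one)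
        _ = slotConst C K ^ τ.length * slotConst C K * (if τ.any (fun t => t.2) then B else 1) := by ring

omit [DecidableEq ι] in
/-- Every selection listed in `annotsPos` takes at least one Q̂″. [cite: Volkov2020, proof of Lemma 3.9 «with at least one multiplier Q̂″_l» (journal p.16; tex l.538–539)] -/
theorem any_of_mem_annotsPos {β : Type*} {l : List β} {τ : List (β × Bool)} (h : τ ∈ annotsPos l) :
    τ.any (fun t => t.2) = true := by
  induction l generalizing τ with
  | nil => simp [annotsPos] at h
  | cons b l ih =>
    simp only [annotsPos, List.mem_append, List.mem_map] at h
    rcases h with ⟨τ', hτ', rfl⟩ | ⟨τ', _, rfl⟩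
    · simp [ih hτ']
    · simp

omit [DecidableEq ι] in
/-- A selection ranges over the given slots (same data, in order). [folklore] -/
private theorem map_fst_of_mem_annots {β : Type*} {l : List β} {τ : List (β × Bool)} (h : τ ∈ annots l) : τ.map Prod.fst = l := by
  induction l generalizing τ with
  | nil => simp [annots] at h; simp [h]
  | cons b l ih =>
    simp only [annots, List.mem_append, List.mem_map] at h
    rcases h with ⟨τ', hτ', rfl⟩ | ⟨τ', hτ', rfl⟩ <;> simp [ih hτ']

omit [DecidableEq ι] in
/-- annotsPos ⊆ annots. [folklore] -/
private theorem mem_annots_of_mem_annotsPos {β : Type*} {l : List β} {τ : List (β × Bool)} (h : τ ∈ annotsPos l) : τ ∈ annots l := by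
  induction l generalizing τ with
  | nil => simp [annotsPos] at h
  | cons b l ih =>
    simp only [annotsPos, annots, List.mem_append, List.mem_map] at h ⊢
    rcases h with ⟨τ', hτ', rfl⟩ | ⟨τ', hτ', rfl⟩
    · exact Or.inl ⟨τ', ih hτ', rfl⟩
    · exact Or.inr ⟨τ', hτ', rfl⟩

omit [DecidableEq ι] in
/-- There are 2^{#slots} selections (removing the brackets of ∏_l ((m + q̂_l) + Q̂″_l)). [cite: Volkov2020, proof of Lemma 3.9 «X can be expressed as
the sum of analogous expressions 𝒫[…] with multipliers Q̂″_l or (m + q̂_l) instead of (m + Q̂′_l)» (journal p.16; arXiv:1912.04885v4 tex l.541)] -/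
theorem length_annots {β : Type*} (l : List β) : (annots l).length = 2 ^ l.length := by
  induction l with
  | nil => rfl
  | cons b l ih => simp [annots, ih, pow_succ]; ring

omit [DecidableEq ι] in
/-- … and fewer than that with a mark. [folklore] -/
private theorem length_annotsPos_le {β : Type*} (l : List β) : (annotsPos l).length ≤ 2 ^ l.length := by
  induction l with
  | nil => simp [annotsPos]
  | cons b l ih => simp [annotsPos, length_annots, pow_succ]; omega

/-- The constant of the bound: 4^{|L|} · γ-bound · slotConst^{#slots} · (number of marked selections, ≤ 2^{nL+nR} + 2^{nR}) — «C is some constant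
that depends only on the structure of the graph (and m)» (and on ‖γ‖, p₁, p₂, K). [cite: Volkov2020, Lemma 3.9 (journal p.16; tex l.525–531)] -/
def assemblyConst (K : ℝ) (nNames nL nR : ℕ) : ℝ :=
  4 ^ nNames * gammaBound C * slotConst C K ^ (nL + nR) * (2 ^ nL * 2 ^ nR + 2 ^ nR)

/-- One selected term: ‖E(wordSel τL τR)‖ ≤ 4^{|L|}·γ-bound·slotConst^{nL+nR}·B when some slot is marked (and the l1-hypotheses hold).
[cite: Volkov2020, proof of Lemma 3.9 (journal p.16; tex l.538–543)] -/
theorem norm_E_wordSel_le {K B : ℝ} (hK : 0 ≤ K) (hB0 : 0 ≤ B) (hB1 : B ≤ 1) (L : List ι)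
    (τL τR : List ((ι × (Fin 4 → ℝ)) × Bool))
    (hL : ∀ t ∈ τL, t.2 = true → l1 (t.1.2 - C.p₂) ≤ K * B) (hR : ∀ t ∈ τR, t.2 = true → l1 (t.1.2 - C.p₁) ≤ K * B)
    (hmark : τL.any (fun t => t.2) = true ∨ τR.any (fun t => t.2) = true) :
    ‖E C L (wordSel C τL τR)‖ ≤ 4 ^ L.length * gammaBound C * slotConst C K ^ (τL.length + τR.length) * B := by
  have hΓ1 := one_le_gammaBound C
  have hΓ0 : 0 ≤ gammaBound C := zero_le_one.trans hΓ1
  have hS := gammaSum_nonneg C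
  have hM0 : 0 ≤ slotConst C K := mul_nonneg hΓ0 ((mul_nonneg hK hS).trans (le_max_left _ _))
  have h1 := norm_E_le C L (wordSel C τL τR)
  have hprod : ((wordSel C τL τR).map (letterBound C)).prod =
      (τL.map (slotBound C C.p₂)).prod * gammaBound C * (τR.map (slotBound C C.p₁)).prod := by
    unfold wordSel
    rw [List.map_append, List.map_append, List.prod_append, List.prod_append, prod_leftSel, prod_rightSel]
    simp [letterBound, mul_assoc]
  have hPL := prod_slotBound_le C hK hB0 hB1 C.p₂ (le_max_right _ _) τL hL
  have hPR := prod_slotBound_le C hK hB0 hB1 C.p₁ (le_max_left _ _) τR hR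
  have hsb0 : ∀ (q : Fin 4 → ℝ) (t : (ι × (Fin 4 → ℝ)) × Bool), 0 ≤ slotBound C q t := fun q t => by
    unfold slotBound
    refine mul_nonneg hΓ0 ?_
    split_ifs
    · exact mul_nonneg (l1_nonneg _) hS
    · exact add_nonneg (abs_nonneg _) (mul_nonneg (l1_nonneg _) hS)
  have hPL0 : 0 ≤ (τL.map (slotBound C C.p₂)).prod := List.prod_nonneg fun x hx => by
    obtain ⟨t, _, rfl⟩ := List.mem_map.1 hx; exact hsb0 _ t
  have hPR0 : 0 ≤ (τR.map (slotBound C C.p₁)).prod := List.prod_nonneg fun x hx => by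
    obtain ⟨t, _, rfl⟩ := List.mem_map.1 hx; exact hsb0 _ t
  -- the two indicator factors multiply to at most B
  have hind : (if τL.any (fun t => t.2) then B else 1) * (if τR.any (fun t => t.2) then B else 1) ≤ B := by
    rcases hmark with h | h <;> simp only [h, if_true]
    · split_ifs <;> nlinarith
    · split_ifs <;> nlinarith
  have hind0 : 0 ≤ (if τL.any (fun t => t.2) then B else 1) * (if τR.any (fun t => t.2) then B else 1) := by
    apply mul_nonneg <;> split_ifs <;> linarith
  rw [hprod] at h1
  refine h1.trans ?_
  calc (4 : ℝ) ^ L.length * ((τL.map (slotBound C C.p₂)).prod * gammaBound C * (τR.map (slotBound C C.p₁)).prod)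
      = 4 ^ L.length * gammaBound C * ((τL.map (slotBound C C.p₂)).prod * (τR.map (slotBound C C.p₁)).prod) := by ring
    _ ≤ 4 ^ L.length * gammaBound C * ((slotConst C K ^ τL.length * (if τL.any (fun t => t.2) then B else 1)) *
          (slotConst C K ^ τR.length * (if τR.any (fun t => t.2) then B else 1))) :=
        mul_le_mul_of_nonneg_left (mul_le_mul hPL hPR hPR0 (mul_nonneg (pow_nonneg hM0 _) (by split_ifs <;> linarith)))
          (mul_nonneg (pow_nonneg (by norm_num) _) hΓ0)
    _ = 4 ^ L.length * gammaBound C * slotConst C K ^ (τL.length + τR.length) *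
          ((if τL.any (fun t => t.2) then B else 1) * (if τR.any (fun t => t.2) then B else 1)) := by rw [pow_add]; ring
    _ ≤ 4 ^ L.length * gammaBound C * slotConst C K ^ (τL.length + τR.length) * B :=
        mul_le_mul_of_nonneg_left hind (mul_nonneg (mul_nonneg (pow_nonneg (by norm_num) _) hΓ0) (pow_nonneg hM0 _))

/-- **THE TERMS WITH AT LEAST ONE Q̂″ ARE O(B).** If every slot vector satisfies l1(Q′_l − q_l) ≤ K·B (q_l = p₂ on the left of γ_μ, p₁ on the
right; 0 ≤ B ≤ 1 — for the graph, B = max_i z′_i/max(z′_i, z_i) and K·B the coefficient bound of B.38/B.40), then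
‖restSum‖ ≤ assemblyConst · B. [cite: Volkov2020, Lemma 3.9 and its proof (journal p.16–17; arXiv:1912.04885v4 tex l.525–556)] -/
theorem norm_restSum_le {K B : ℝ} (hK : 0 ≤ K) (hB0 : 0 ≤ B) (hB1 : B ≤ 1) (L : List ι) (Ls Rs : List (ι × (Fin 4 → ℝ)))
    (hLs : ∀ iq ∈ Ls, l1 (iq.2 - C.p₂) ≤ K * B) (hRs : ∀ jq ∈ Rs, l1 (jq.2 - C.p₁) ≤ K * B) :
    ‖restSum C L Ls Rs‖ ≤ assemblyConst C K L.length Ls.length Rs.length * B := by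
  have hΓ1 := one_le_gammaBound C
  have hΓ0 : 0 ≤ gammaBound C := zero_le_one.trans hΓ1
  have hS := gammaSum_nonneg C
  have hM0 : 0 ≤ slotConst C K := mul_nonneg hΓ0 ((mul_nonneg hK hS).trans (le_max_left _ _))
  set M := (4 : ℝ) ^ L.length * gammaBound C * slotConst C K ^ (Ls.length + Rs.length) * B with hM
  have hMnn : 0 ≤ M := by
    rw [hM]; exact mul_nonneg (mul_nonneg (mul_nonneg (pow_nonneg (by norm_num) _) hΓ0) (pow_nonneg hM0 _)) hB0
  -- transfer of the hypotheses to selections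
  have hselL : ∀ τ ∈ annots Ls, ∀ t ∈ τ, t.2 = true → l1 (t.1.2 - C.p₂) ≤ K * B := by
    intro τ hτ t ht _
    have h := map_fst_of_mem_annots hτ
    exact hLs t.1 (by rw [← h]; exact List.mem_map.2 ⟨t, ht, rfl⟩)
  have hselR : ∀ τ ∈ annots Rs, ∀ t ∈ τ, t.2 = true → l1 (t.1.2 - C.p₁) ≤ K * B := by
    intro τ hτ t ht _
    have h := map_fst_of_mem_annots hτ
    exact hRs t.1 (by rw [← h]; exact List.mem_map.2 ⟨t, ht, rfl⟩)
  have hlenL : ∀ τ ∈ annots Ls, τ.length = Ls.length := fun τ hτ => by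
    have h := congrArg List.length (map_fst_of_mem_annots hτ); simpa using h
  have hlenR : ∀ τ ∈ annots Rs, τ.length = Rs.length := fun τ hτ => by
    have h := congrArg List.length (map_fst_of_mem_annots hτ); simpa using h
  -- each term of either double sum is ≤ M
  have hterm : ∀ τL ∈ annots Ls, ∀ τR ∈ annots Rs,
      (τL.any (fun t => t.2) = true ∨ τR.any (fun t => t.2) = true) → ‖E C L (wordSel C τL τR)‖ ≤ M := by
    intro τL hτL τR hτR hmark
    have h := norm_E_wordSel_le C hK hB0 hB1 L τL τR (hselL τL hτL) (hselR τR hτR) hmark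
    rwa [hlenL τL hτL, hlenR τR hτR] at h
  -- the unmarked left selection is in annots Ls
  have hfalse : (Ls.map fun b => (b, false)) ∈ annots Ls := by
    clear hLs hselL hlenL hterm hM hMnn M
    induction Ls with
    | nil => simp [annots]
    | cons b l ih => simp only [annots, List.map_cons, List.mem_append, List.mem_map]; exact Or.inl ⟨_, ih, rfl⟩
  unfold restSum
  refine (norm_add_le _ _).trans ?_
  have hA : ‖((annotsPos Ls).map fun τL => ((annots Rs).map fun τR => E C L (wordSel C τL τR)).sum).sum‖ ≤
      (2 ^ Ls.length * 2 ^ Rs.length : ℕ) * M := by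
    refine (norm_list_sum_le' _).trans ?_
    rw [List.map_map]
    have h1 : ∀ x ∈ (annotsPos Ls).map (fun τL => ‖((annots Rs).map fun τR => E C L (wordSel C τL τR)).sum‖),
        x ≤ (2 ^ Rs.length : ℕ) * M := by
      intro x hx
      obtain ⟨τL, hτL, rfl⟩ := List.mem_map.1 hx
      refine (norm_list_sum_le' _).trans ?_
      rw [List.map_map]
      have h2 : ∀ y ∈ (annots Rs).map (fun τR => ‖E C L (wordSel C τL τR)‖), y ≤ M := by
        intro y hy
        obtain ⟨τR, hτR, rfl⟩ := List.mem_map.1 hy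
        exact hterm τL (mem_annots_of_mem_annotsPos hτL) τR hτR (Or.inl (any_of_mem_annotsPos hτL))
      refine (List.sum_le_card_nsmul _ _ h2).trans ?_
      rw [List.length_map, length_annots, nsmul_eq_mul]
    refine (List.sum_le_card_nsmul _ _ h1).trans ?_
    rw [List.length_map, nsmul_eq_mul]
    calc ((annotsPos Ls).length : ℝ) * ((2 ^ Rs.length : ℕ) * M) ≤ (2 ^ Ls.length : ℕ) * ((2 ^ Rs.length : ℕ) * M) :=
          mul_le_mul_of_nonneg_right (by exact_mod_cast length_annotsPos_le Ls) (mul_nonneg (by positivity) hMnn)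
      _ = (2 ^ Ls.length * 2 ^ Rs.length : ℕ) * M := by push_cast; ring
  have hB' : ‖((annotsPos Rs).map fun τR => E C L (wordSel C (Ls.map fun b => (b, false)) τR)).sum‖ ≤
      (2 ^ Rs.length : ℕ) * M := by
    refine (norm_list_sum_le' _).trans ?_
    rw [List.map_map]
    have h2 : ∀ y ∈ (annotsPos Rs).map (fun τR => ‖E C L (wordSel C (Ls.map fun b => (b, false)) τR)‖), y ≤ M := by
      intro y hy
      obtain ⟨τR, hτR, rfl⟩ := List.mem_map.1 hy
      exact hterm _ hfalse τR (mem_annots_of_mem_annotsPos hτR) (Or.inr (any_of_mem_annotsPos hτR))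
    refine (List.sum_le_card_nsmul _ _ h2).trans ?_
    rw [List.length_map, nsmul_eq_mul]
    exact mul_le_mul_of_nonneg_right (by exact_mod_cast length_annotsPos_le Rs) hMnn
  refine (add_le_add hA hB').trans (le_of_eq ?_)
  rw [hM, assemblyConst]
  push_cast
  ring

end RestBound

/-! ## §9 (r2) Lemma 3.9 modulo the projector: X ≈ c·γ_μ + R with ‖R‖ ≤ C·B, and |𝒫[X]| ≤ ‖𝒫‖·C·B for every admissible 𝒫 -/

section Assembly

variable {A : Type*} [NormedRing A] [NormedAlgebra ℝ A] [NormOneClass A]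
variable (C : Ctx A) {ι : Type*} [DecidableEq ι]
variable (hγ : IsDirac C.γ)
include hγ

/-- **LEMMA 3.9 MODULO 𝒫.** For every normed Clifford family, m ≠ 0, p₁² = p₂² = m², every pairing of the vertex names, and slot vectors Q′_l
with l1(Q′_l − q_l) ≤ K·B (0 ≤ B ≤ 1): X = E(wordQ) is on-shell-equivalent to c·γ_μ + R with ‖R‖ ≤ assemblyConst·B — so any functional 𝒫
killing the on-shell ideal and γ_μ («𝒫γ_μ = 0») sees |𝒫[X]| ≤ ‖𝒫‖·assemblyConst·B, which is (3.11) with B = max_i z′_i/max(z′_i, z_i).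
[cite: Volkov2020, Lemma 3.9 eq. (3.11) and its proof (journal p.16–17; arXiv:1912.04885v4 tex l.525–556)] -/
theorem lemma39_modulo_projector (hm : C.m ≠ 0) (h1 : dot C.p₁ C.p₁ = C.m ^ 2) (h2 : dot C.p₂ C.p₂ = C.m ^ 2)
    (Ls Rs : List (ι × (Fin 4 → ℝ))) (L : List ι) (hL : L.Nodup)
    (hnames : ∀ i, i ∈ L ↔ i ∈ Ls.map Prod.fst ++ Rs.map Prod.fst)
    (hcount : ∀ i ∈ Ls.map Prod.fst ++ Rs.map Prod.fst, (Ls.map Prod.fst ++ Rs.map Prod.fst).count i = 2)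
    {K B : ℝ} (hK : 0 ≤ K) (hB0 : 0 ≤ B) (hB1 : B ≤ 1)
    (hLs : ∀ iq ∈ Ls, l1 (iq.2 - C.p₂) ≤ K * B) (hRs : ∀ jq ∈ Rs, l1 (jq.2 - C.p₁) ≤ K * B) :
    ∃ c : ℝ, ∃ R : A, OnShellEq C.γ C.m C.p₁ C.p₂ (E C L (wordQ Ls Rs)) (c • C.γ C.μ + R) ∧
      ‖R‖ ≤ assemblyConst C K L.length Ls.length Rs.length * B := by
  obtain ⟨c, hc⟩ := lemma39_step1 C hγ hm h1 h2 Ls Rs L hL hnames hcount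
  exact ⟨c, restSum C L Ls Rs, hc, norm_restSum_le C hK hB0 hB1 L Ls Rs hLs hRs⟩

omit [NormOneClass A] hγ in
/-- On-shell-equivalent elements have the same image under a functional vanishing on the two one-sided ideals A(p̂₁ − m), (p̂₂ − m)A
(«we consider only expressions of the form ψ̄₂Γ(p₁,p₂)ψ₁, where (m − p̂₁)ψ₁ = 0, ψ̄₂(m − p̂₂) = 0»).
[cite: Volkov2020, proof of Lemma 3.8, first sentence (journal p.15; arXiv:1912.04885v4 tex l.497–499)] -/
theorem functional_eq_of_onShellEq (P : A →ₗ[ℝ] ℝ)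
    (hP1 : ∀ U : A, P (U * (sl C.γ C.p₁ - C.m • (1 : A))) = 0) (hP2 : ∀ V : A, P ((sl C.γ C.p₂ - C.m • (1 : A)) * V) = 0)
    {X Y : A} (h : OnShellEq C.γ C.m C.p₁ C.p₂ X Y) : P X = P Y := by
  obtain ⟨U, V, hUV⟩ := h
  have : P (X - Y) = 0 := by rw [hUV, map_add, hP1, hP2, add_zero]
  rwa [map_sub, sub_eq_zero] at this

/-- **(3.11) for every admissible projector functional**: if 𝒫 : A → ℝ is linear, vanishes on A(p̂₁ − m) and (p̂₂ − m)A and on γ_μ («𝒫γ_μ = 0»), and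
is bounded by N (|𝒫 x| ≤ N‖x‖), then |𝒫[X]| ≤ N · assemblyConst · B under the hypotheses of `lemma39_modulo_projector`.
[cite: Volkov2020, Lemma 3.9 eq. (3.11) «|Σ_{j:P_j=P}[𝒫Π_j]Y_j(z)| ≤ C·max_{i∈Ph(E(G))} z′_i/max(z′_i, z_i)» (journal p.16; arXiv:1912.04885v4 tex l.525–531); §2.2.2 «𝒫γ_μ = 0» (journal p.9; tex l.272–274)] -/
theorem abs_projector_le (hm : C.m ≠ 0) (h1 : dot C.p₁ C.p₁ = C.m ^ 2) (h2 : dot C.p₂ C.p₂ = C.m ^ 2)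
    (Ls Rs : List (ι × (Fin 4 → ℝ))) (L : List ι) (hL : L.Nodup)
    (hnames : ∀ i, i ∈ L ↔ i ∈ Ls.map Prod.fst ++ Rs.map Prod.fst)
    (hcount : ∀ i ∈ Ls.map Prod.fst ++ Rs.map Prod.fst, (Ls.map Prod.fst ++ Rs.map Prod.fst).count i = 2)
    {K B : ℝ} (hK : 0 ≤ K) (hB0 : 0 ≤ B) (hB1 : B ≤ 1)
    (hLs : ∀ iq ∈ Ls, l1 (iq.2 - C.p₂) ≤ K * B) (hRs : ∀ jq ∈ Rs, l1 (jq.2 - C.p₁) ≤ K * B)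
    (P : A →ₗ[ℝ] ℝ) (hP1 : ∀ U : A, P (U * (sl C.γ C.p₁ - C.m • (1 : A))) = 0)
    (hP2 : ∀ V : A, P ((sl C.γ C.p₂ - C.m • (1 : A)) * V) = 0) (hPμ : P (C.γ C.μ) = 0)
    {N : ℝ} (hN : ∀ x : A, |P x| ≤ N * ‖x‖) :
    |P (E C L (wordQ Ls Rs))| ≤ N * (assemblyConst C K L.length Ls.length Rs.length * B) := by
  obtain ⟨c, R, hXR, hR⟩ := lemma39_modulo_projector C hγ hm h1 h2 Ls Rs L hL hnames hcount hK hB0 hB1 hLs hRs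
  have hN0 : 0 ≤ N := by
    have h1' := hN 1
    rw [norm_one, mul_one] at h1'
    exact (abs_nonneg _).trans h1'
  rw [functional_eq_of_onShellEq C P hP1 hP2 hXR, map_add, map_smul, hPμ, smul_zero, zero_add]
  exact (hN R).trans (mul_le_mul_of_nonneg_left hR hN0)

end Assembly

end ProjectorVanishing

end Literature.MathematicalPhysics.QuantumFieldTheory.Volkov2020

namespace Literature.MathematicalPhysics.QuantumFieldTheory.Volkov2020

namespace ProjectorVanishing

open AppendixNumerators Letter Finset

/-! ## §10 (r3) (3.11) for the PARAMETRIC slot vectors: B.38's coefficient bound threaded into §9 -/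

section Parametric

variable {A : Type*} [NormedRing A] [NormedAlgebra ℝ A] [NormOneClass A]
variable (C : Ctx A) {ι : Type*} [DecidableEq ι]
variable {nE : ℕ}

/-- **The right-hand side of (3.11)**: B(z) = max_{i∈Ph(E(G))} z′_i/max(z′_i, z_i), z′_i = max over the lepton path of i (`lineMax`).
[cite: Volkov2020, Lemma 3.9 eq. (3.11) (journal p.16; arXiv:1912.04885v4 tex l.525–531)] -/
noncomputable def exchBound (z : Fin nE → ℝ) (Ph : Finset (Fin nE)) (hPh : Ph.Nonempty) (lpath : Fin nE → Finset (Fin nE)) : ℝ :=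
  Ph.sup' hPh fun i => lineMax z (lpath i) / max (lineMax z (lpath i)) (z i)

omit [NormOneClass A] [DecidableEq ι] in
/-- 0 ≤ z′_i for positive parameters. [cite: Volkov2020, Lemma 3.4 «z′_i = max_{l∈LPath(i)} z_l» (journal p.12; arXiv:1912.04885v4 tex l.366–368)] -/
private theorem lineMax_nonneg (z : Fin nE → ℝ) (hz : ∀ k, 0 < z k) (P : Finset (Fin nE)) : 0 ≤ lineMax z P := by
  unfold lineMax
  split_ifs with h
  · obtain ⟨k, hk⟩ := h
    exact (hz k).le.trans (le_sup' z hk)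
  · exact le_rfl

/-- 0 ≤ B(z) ≤ 1 for positive parameters. [cite: Volkov2020, Lemma 3.9 eq. (3.11) (journal p.16; arXiv:1912.04885v4 tex l.525–531)] -/
theorem exchBound_nonneg_le_one (z : Fin nE → ℝ) (hz : ∀ k, 0 < z k) (Ph : Finset (Fin nE)) (hPh : Ph.Nonempty)
    (lpath : Fin nE → Finset (Fin nE)) : 0 ≤ exchBound z Ph hPh lpath ∧ exchBound z Ph hPh lpath ≤ 1 := by
  obtain ⟨i₀, hi₀⟩ := hPh
  have hterm : ∀ i, 0 ≤ lineMax z (lpath i) / max (lineMax z (lpath i)) (z i) ∧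
      lineMax z (lpath i) / max (lineMax z (lpath i)) (z i) ≤ 1 := fun i =>
    ⟨div_nonneg (lineMax_nonneg z hz _) ((hz i).le.trans (le_max_right _ _)),
      div_le_one_of_le₀ (le_max_left _ _) ((hz i).le.trans (le_max_right _ _))⟩
  unfold exchBound
  exact ⟨(hterm i₀).1.trans (le_sup' (fun i => lineMax z (lpath i) / max (lineMax z (lpath i)) (z i)) hi₀),
    sup'_le _ _ fun i _ => (hterm i).2⟩

/-- **A PARAMETRIC SLOT**: the slot vector v = Q′_l of the lepton line l ∈ Lept(E(G)) differs from q_l by Q″_l = (Q_l(z) − q_l D(z))/D(z) written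
in the basis p₁, p₂ — each coordinate is B.38's `qCoeff` for coordinates c(T) of p[T] and c₀ of q_l with |c(T)| ≤ 1, |c₀| ≤ 1 and c(Lept) = c₀
(«the momentum passing through l in T equals q_l» for T = Lept(E(G)); for vertex graphs these three facts are `Volkov2020.MomentumRouting`'s
`abs_momentumCoeffs_le_one` / `momentumThrough_path`). [cite: Volkov2020, §2.2.1 «Q_l(z) = Σ_T p[T]∏ z» and proof of Lemma 3.9 «Q″_l = (Q_l(z) − q_l D(z))/D(z) … the coefficients c(T) are linear combinations of p₁, p₂. The terms corresponding to T are cancelled if l ∈ T and the momentum passing through l in T equals q_l» (journal p.8, p.16; arXiv:1912.04885v4 tex l.226–231, l.544–548)] -/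
def ParametricSlot (M : Matroid (Fin nE)) (z : Fin nE → ℝ) (Lept : Finset (Fin nE)) (q v : Fin 4 → ℝ) : Prop :=
  ∃ l ∈ Lept, ∃ (c₁ c₂ : Finset (Fin nE) → ℝ) (e₁ e₂ : ℝ),
    (∀ T, |c₁ T| ≤ 1) ∧ |e₁| ≤ 1 ∧ c₁ Lept = e₁ ∧ (∀ T, |c₂ T| ≤ 1) ∧ |e₂| ≤ 1 ∧ c₂ Lept = e₂ ∧
      v - q = qCoeff M z l c₁ e₁ • C.p₁ + qCoeff M z l c₂ e₂ • C.p₂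

/-- **The structure constant K of the slot hypothesis**: 2(#1-trees − 1)·(l1 p₁ + l1 p₂).
[cite: Volkov2020, Lemma 3.9 «C is some constant that depends only on the structure of the graph (and m)» (journal p.16; arXiv:1912.04885v4 tex l.530)] -/
noncomputable def slotK (M : Matroid (Fin nE)) : ℝ :=
  2 * (((oneTrees M).card - 1 : ℕ) : ℝ) * (l1 C.p₁ + l1 C.p₂)

omit [NormOneClass A] [DecidableEq ι] in
/-- 0 ≤ K. [cite: Volkov2020, Lemma 3.9 (journal p.16; arXiv:1912.04885v4 tex l.530)] -/
theorem slotK_nonneg (M : Matroid (Fin nE)) : 0 ≤ slotK C M := by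
  unfold slotK l1
  exact mul_nonneg (mul_nonneg (by norm_num) (Nat.cast_nonneg _))
    (add_nonneg (sum_nonneg fun _ _ => abs_nonneg _) (sum_nonneg fun _ _ => abs_nonneg _))

omit [NormOneClass A] [DecidableEq ι] in
/-- ℓ¹ size of a combination a·p₁ + b·p₂. [cite: Volkov2020, proof of Lemma 3.9 «linear combinations of p̂₁, p̂₂» (journal p.16; arXiv:1912.04885v4 tex l.543)] -/
private theorem l1_comb_le (a b : ℝ) : l1 (a • C.p₁ + b • C.p₂) ≤ |a| * l1 C.p₁ + |b| * l1 C.p₂ := by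
  unfold l1
  rw [mul_sum, mul_sum, ← sum_add_distrib]
  refine sum_le_sum fun α _ => ?_
  simp only [Pi.add_apply, Pi.smul_apply, smul_eq_mul]
  calc |a * C.p₁ α + b * C.p₂ α| ≤ |a * C.p₁ α| + |b * C.p₂ α| := abs_add_le _ _
    _ = |a| * |C.p₁ α| + |b| * |C.p₂ α| := by rw [abs_mul, abs_mul]

omit [NormOneClass A] [DecidableEq ι] in
/-- **THE SLOT HYPOTHESIS OF §8–§9, DISCHARGED BY B.38**: in the setting of `abs_qCoeff_le` (Lept(E(G)) a 1-tree, every other line a photon whose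
lepton path lies in Lept and spans it), a parametric slot satisfies l1(Q′_l − q_l) ≤ K · max_i z′_i/max(z′_i, z_i).
[cite: Volkov2020, Lemma 3.9 (3.11) and its proof «it is sufficient to estimate the coefficients of Q″_l … X′_T ≤ z′_i/max(z_i, z′_i)» (journal p.16–17; arXiv:1912.04885v4 tex l.543–558)] -/
theorem l1_sub_le_of_parametricSlot (M : Matroid (Fin nE)) (z : Fin nE → ℝ) (hz : ∀ k, 0 < z k)
    (Ph Lept : Finset (Fin nE)) (lpath : Fin nE → Finset (Fin nE))
    (hcover : ∀ l, l ∉ Lept → l ∈ Ph) (hLept : M.IsBase (Lept : Set (Fin nE)))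
    (hsub : ∀ i ∈ Ph, lpath i ⊆ Lept) (hcl : ∀ i ∈ Ph, i ∈ M.closure (lpath i : Set (Fin nE))) (hPh : Ph.Nonempty)
    {q v : Fin 4 → ℝ} (h : ParametricSlot C M z Lept q v) :
    l1 (v - q) ≤ slotK C M * exchBound z Ph hPh lpath := by
  obtain ⟨l, hl, c₁, c₂, e₁, e₂, hc₁, he₁, hce₁, hc₂, he₂, hce₂, hv⟩ := h
  have h₁ := abs_qCoeff_le M z hz Ph Lept lpath hcover hLept hsub hcl hPh hl c₁ e₁ hc₁ he₁ hce₁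
  have h₂ := abs_qCoeff_le M z hz Ph Lept lpath hcover hLept hsub hcl hPh hl c₂ e₂ hc₂ he₂ hce₂
  rw [hv]
  refine (l1_comb_le C _ _).trans ?_
  calc |qCoeff M z l c₁ e₁| * l1 C.p₁ + |qCoeff M z l c₂ e₂| * l1 C.p₂
      ≤ (2 * (((oneTrees M).card - 1 : ℕ) : ℝ) * exchBound z Ph hPh lpath) * l1 C.p₁ +
        (2 * (((oneTrees M).card - 1 : ℕ) : ℝ) * exchBound z Ph hPh lpath) * l1 C.p₂ :=
        add_le_add (mul_le_mul_of_nonneg_right h₁ (l1_nonneg C.p₁)) (mul_le_mul_of_nonneg_right h₂ (l1_nonneg C.p₂))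
    _ = slotK C M * exchBound z Ph hPh lpath := by unfold slotK; ring

variable (hγ : IsDirac C.γ)
include hγ

/-- **LEMMA 3.9 (3.11) FOR THE PARAMETRIC NUMERATOR, MODULO 𝒫.** In the setting of B.38 (Lept(E(G)) a 1-tree of the cycle matroid, photons with
spanning lepton paths, z > 0), if every slot of X carries a parametric slot vector Q′_l (its Q″_l = B.38's coefficients in the basis p₁, p₂;
q_l = p₂ left of γ_μ, p₁ right of it), then X ≈ c·γ_μ + R with ‖R‖ ≤ assemblyConst(K) · max_{i∈Ph} z′_i/max(z′_i, z_i).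
[cite: Volkov2020, Lemma 3.9 eq. (3.11) and its proof (journal p.16–17; arXiv:1912.04885v4 tex l.525–559)] -/
theorem lemma39_parametric (hm : C.m ≠ 0) (h1 : dot C.p₁ C.p₁ = C.m ^ 2) (h2 : dot C.p₂ C.p₂ = C.m ^ 2)
    (M : Matroid (Fin nE)) (z : Fin nE → ℝ) (hz : ∀ k, 0 < z k)
    (Ph Lept : Finset (Fin nE)) (lpath : Fin nE → Finset (Fin nE))
    (hcover : ∀ l, l ∉ Lept → l ∈ Ph) (hLept : M.IsBase (Lept : Set (Fin nE)))
    (hsub : ∀ i ∈ Ph, lpath i ⊆ Lept) (hcl : ∀ i ∈ Ph, i ∈ M.closure (lpath i : Set (Fin nE))) (hPh : Ph.Nonempty)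
    (Ls Rs : List (ι × (Fin 4 → ℝ))) (L : List ι) (hL : L.Nodup)
    (hnames : ∀ i, i ∈ L ↔ i ∈ Ls.map Prod.fst ++ Rs.map Prod.fst)
    (hcount : ∀ i ∈ Ls.map Prod.fst ++ Rs.map Prod.fst, (Ls.map Prod.fst ++ Rs.map Prod.fst).count i = 2)
    (hLs : ∀ iq ∈ Ls, ParametricSlot C M z Lept C.p₂ iq.2) (hRs : ∀ jq ∈ Rs, ParametricSlot C M z Lept C.p₁ jq.2) :
    ∃ c : ℝ, ∃ R : A, OnShellEq C.γ C.m C.p₁ C.p₂ (E C L (wordQ Ls Rs)) (c • C.γ C.μ + R) ∧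
      ‖R‖ ≤ assemblyConst C (slotK C M) L.length Ls.length Rs.length * exchBound z Ph hPh lpath := by
  have hB := exchBound_nonneg_le_one z hz Ph hPh lpath
  exact lemma39_modulo_projector C hγ hm h1 h2 Ls Rs L hL hnames hcount (slotK_nonneg C M) hB.1 hB.2
    (fun iq hiq => l1_sub_le_of_parametricSlot C M z hz Ph Lept lpath hcover hLept hsub hcl hPh (hLs iq hiq))
    (fun jq hjq => l1_sub_le_of_parametricSlot C M z hz Ph Lept lpath hcover hLept hsub hcl hPh (hRs jq hjq))

/-- **(3.11) FOR EVERY ADMISSIBLE 𝒫 ON THE PARAMETRIC NUMERATOR**: |𝒫[X]| ≤ N · assemblyConst(K) · max_{i∈Ph(E(G))} z′_i/max(z′_i, z_i) — the printed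
right-hand side with C = N·assemblyConst(2(#1-trees − 1)(l1 p₁ + l1 p₂)) explicit.
[cite: Volkov2020, Lemma 3.9 eq. (3.11) «|Σ_{j:P_j=P}[𝒫Π_j]Y_j(z)| ≤ C·max_{i∈Ph(E(G))} z′_i/max(z′_i, z_i)» (journal p.16; arXiv:1912.04885v4 tex l.525–531)] -/
theorem abs_projector_le_parametric (hm : C.m ≠ 0) (h1 : dot C.p₁ C.p₁ = C.m ^ 2) (h2 : dot C.p₂ C.p₂ = C.m ^ 2)
    (M : Matroid (Fin nE)) (z : Fin nE → ℝ) (hz : ∀ k, 0 < z k)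
    (Ph Lept : Finset (Fin nE)) (lpath : Fin nE → Finset (Fin nE))
    (hcover : ∀ l, l ∉ Lept → l ∈ Ph) (hLept : M.IsBase (Lept : Set (Fin nE)))
    (hsub : ∀ i ∈ Ph, lpath i ⊆ Lept) (hcl : ∀ i ∈ Ph, i ∈ M.closure (lpath i : Set (Fin nE))) (hPh : Ph.Nonempty)
    (Ls Rs : List (ι × (Fin 4 → ℝ))) (L : List ι) (hL : L.Nodup)
    (hnames : ∀ i, i ∈ L ↔ i ∈ Ls.map Prod.fst ++ Rs.map Prod.fst)
    (hcount : ∀ i ∈ Ls.map Prod.fst ++ Rs.map Prod.fst, (Ls.map Prod.fst ++ Rs.map Prod.fst).count i = 2)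
    (hLs : ∀ iq ∈ Ls, ParametricSlot C M z Lept C.p₂ iq.2) (hRs : ∀ jq ∈ Rs, ParametricSlot C M z Lept C.p₁ jq.2)
    (P : A →ₗ[ℝ] ℝ) (hP1 : ∀ U : A, P (U * (sl C.γ C.p₁ - C.m • (1 : A))) = 0)
    (hP2 : ∀ V : A, P ((sl C.γ C.p₂ - C.m • (1 : A)) * V) = 0) (hPμ : P (C.γ C.μ) = 0)
    {N : ℝ} (hN : ∀ x : A, |P x| ≤ N * ‖x‖) :
    |P (E C L (wordQ Ls Rs))| ≤
      N * (assemblyConst C (slotK C M) L.length Ls.length Rs.length * exchBound z Ph hPh lpath) := by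
  have hB := exchBound_nonneg_le_one z hz Ph hPh lpath
  exact abs_projector_le C hγ hm h1 h2 Ls Rs L hL hnames hcount (slotK_nonneg C M) hB.1 hB.2
    (fun iq hiq => l1_sub_le_of_parametricSlot C M z hz Ph Lept lpath hcover hLept hsub hcl hPh (hLs iq hiq))
    (fun jq hjq => l1_sub_le_of_parametricSlot C M z hz Ph Lept lpath hcover hLept hsub hcl hPh (hRs jq hjq))
    P hP1 hP2 hPμ hN

end Parametric

end ProjectorVanishing

end Literature.MathematicalPhysics.QuantumFieldTheory.Volkov2020
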